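import Literature.Analysis.FluidPDE.OnsagerCCFSTestField
import Literature.Analysis.FluidPDE.CoarseGrainingEstimates
import Literature.Analysis.FluidPDE.WeakSolution
import HarnessLib

/-!
# The resolved energy balance of forced weak Navier–Stokes solutions on `T^d`, distributional form

Analysis/FluidPDE file, theorem-only (first half of the discharge of the named fact
`Torus.IsLerayHopfOn.resolvedEnergyBalance`, `FluidPDE/LerayResolvedEnergy` = Drivas–Eyink 2019,
Lemma 2, on which the barrier `Literature.Barriers.AnomalousDissipation.DrivasEyink2019_lemma1_measurable`
rests). Main result `Torus.IsWeakNSSolutionForcedOn.resolvedEnergyBalance_distrib`: for a forced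
weak (pressure-free) solution `u` of the Navier–Stokes equations on `T^d × [0,T)`
(`Torus.IsWeakNSSolutionForcedOn T ν f u₀ u`) with `u ∈ L³_{t,x}`, a jointly measurable force
`f ∈ L²_{t,x}`, the torus mollifier `K = K_ε` and every cut-off `θ ∈ C_c^∞(0,T)`,

  `∫₀ᵀ θ' E(u ⋆ K) = -∫₀ᵀ θ Π_K[u] + ν ∫₀ᵀ θ ‖∇(u ⋆ K)‖₂² - ∫₀ᵀ θ ∫⟪f ⋆ K, u ⋆ K⟫`,

i.e. `d/dt ½‖ū‖₂² = Π_K[u] - ν‖∇ū‖₂² + ∫ ū·f̄` in `𝒟'(0,T)` — the space-integrated form of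
Drivas–Eyink's local resolved balance (op. cit. Lemma 2: "`∂ₜ(½|ū_ℓ|²) + ∇·J_ℓ =
-Π_ℓ - ν|∇ū_ℓ|² + ū_ℓ·f̄_ℓ`", with `∫Π_ℓ dx = -Π_K` for divergence-free `ū`,
`Torus.cetFlux`). The printed derivation mollifies the equations in space only and argues
pointwise in `x` with absolutely continuous `t ↦ ū_ℓ(x,t)`; here, exactly as in the tree's
Euler case `Torus.energyBalance_vecConv_holds` (`FluidPDE/OnsagerCCFSTestField`, CCFS 2008 (11)),
the weak formulation is tested with the legitimate doubly mollified, time-regularised,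
divergence-free fields `ψₙ = ρₙ ⋆ₜ (θ · ((ρₙ ⋆ₜ ū) ⋆ₓ K)) ⋆ₓ K` and `n → ∞` is taken. Compared
with the Euler case the forced Navier–Stokes identity (`Torus.weakFormNS_rewrite`) has two more
*linear* pairings:
* `ν ∫∫ ⟪u, Δψₙ⟫`: the Laplacian falls on the space kernel (`Torus.laplacian_cetTest_eq`:
  `Δψₙ = ∑ᵢ ρₙ ⋆ₜ (θ · (ρₙ ⋆ₜ Lᵢ))`, `Lᵢ = (ū ⋆ K) ⋆ ∂ᵢ∂ᵢK`), the iterated time mollifications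
  converge in `L²_{t,x}` (`Torus.tendsto_eLpNorm_iteratedTimeConv_sub`), and the limit pairing
  `∑ⱼᵢ ∫ uⱼ ((uⱼ ⋆ K) ⋆ ∂ᵢ∂ᵢK) = -‖∇(u ⋆ K)‖₂²` is Green's identity on `T^d` after moving the
  derivatives and the even kernel across (`Torus.sum_integral_mul_sliceL_eq_neg_gradNormSq`,
  `Torus.integral_sum_mul_cutoff_sliceL_eq`);
* `∫∫ ⟪f, ψₙ⟫`: `ψₙ → θ (ū ⋆ K) ⋆ K` in `L²_{t,x}`, `f ∈ L²_{t,x}`, and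
  `∑ⱼ ∫ fⱼ ((uⱼ ⋆ K) ⋆ K) = ∫⟪f ⋆ K, u ⋆ K⟫` by evenness of `K`
  (`Torus.sum_integral_mul_sliceC_eq_integral_inner`, `Torus.integral_sum_mul_cutoff_sliceC_eq`).
The time-derivative and convective pairings are those of the Euler case, reused verbatim
(`Torus.integral_mul_timeDeriv_cetTest`, `Torus.integral_sum_mul_cutoff_sliceB_eq`).

The passage from this distributional identity to the pointwise balance on `(0,T]` with the datum
(weak `L²` continuity of Leray–Hopf solutions) and the integrability of the three right-hand
sides are the second half of the discharge (sibling file, to follow).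

## Mathlib search

Mathlib (this pin): convolution on `ℝ` with bump kernels (`ContDiffBump.normed`), Fubini
(`integral_prod`, `Integrable.integral_prod_left`), Hölder (`MemLp.integrable_mul`); no weak
formulations. Everything specific comes from the tree (`OnsagerCCFSTestField`,
`TorusSpaceTimeConvolution`, `TimeMollification`, `TorusCalculusProofs`).

## References

* T. D. Drivas, G. L. Eyink, *An Onsager singularity theorem for Leray solutions of
  incompressible Navier–Stokes*, Nonlinearity 32 (2019) 4465–4482 = arXiv:1710.05205, Lemma 2
  and §2, proof of Lemma 2. [DrivasEyink2019]
* A. Cheskidov, P. Constantin, S. Friedlander, R. Shvydkoy, Nonlinearity 21 (2008), §3.2 (11).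
  [CCFS2008]
* P. Constantin, W. E, E. S. Titi, Comm. Math. Phys. 165 (1994), p. 208. [ConstantinETiti1994]
-/

noncomputable section

open MeasureTheory TopologicalSpace Set Function Filter Metric
open _root_.Topology
open scoped ENNReal NNReal Convolution ContDiff InnerProductSpace

namespace Literature.Analysis.FluidPDE

namespace Torus

variable {d : Type*} [Fintype d]

/-! ## Vector test fields: the Laplacian componentwise -/

section VecLaplacian

variable [DecidableEq d] {ψc : d → ℝ → UnitAddTorus d → ℝ}

/-- For a smooth field `V : T^d → ℝ^ι`, `(ΔV)(x) j = Δ(V · j)(x)`. [folklore] -/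
theorem laplacian_apply_eq {ι : Type*} [Fintype ι] {V : UnitAddTorus d → EuclideanSpace ℝ ι}
    (hV : FunctionSpaces.Torus.IsSmooth V) (x : UnitAddTorus d) (j : ι) :
    FunctionSpaces.Torus.laplacian V x j = FunctionSpaces.Torus.laplacian (fun y => V y j) x := by
  have hVj : FunctionSpaces.Torus.IsSmooth (fun y => V y j) :=
    (EuclideanSpace.proj j : EuclideanSpace ℝ ι →L[ℝ] ℝ).contDiff.comp hV
  rw [FunctionSpaces.Torus.laplacian_eq_sum_partialDeriv_partialDeriv hV,
    FunctionSpaces.Torus.laplacian_eq_sum_partialDeriv_partialDeriv hVj]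
  rw [show (∑ i, FunctionSpaces.Torus.partialDeriv i (FunctionSpaces.Torus.partialDeriv i V) x) j =
      ∑ i, FunctionSpaces.Torus.partialDeriv i (FunctionSpaces.Torus.partialDeriv i V) x j by simp]
  refine Finset.sum_congr rfl fun i _ => ?_
  have h1 : (fun y => FunctionSpaces.Torus.partialDeriv i V y j) = FunctionSpaces.Torus.partialDeriv i (fun y => V y j) :=
    funext fun y => partialDeriv_apply_eq (hV.isContDiff (by simp)) i y j
  rw [partialDeriv_apply_eq ((hV.partialDeriv i).isContDiff (by simp)) i x j, h1]

/-- The pairing with the Laplacian, componentwise: `⟪v, Δψ⟫ = ∑ⱼ vⱼ Δψⱼ` for a field with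
smooth components. [folklore] -/
theorem inner_laplacian_vecField {t : ℝ} (hs : ∀ j, FunctionSpaces.Torus.IsSmooth (ψc j t))
    (v : EuclideanSpace ℝ d) (x : UnitAddTorus d) :
    ⟪v, FunctionSpaces.Torus.laplacian (vecField ψc t) x⟫_ℝ = ∑ j, v j * FunctionSpaces.Torus.laplacian (ψc j t) x := by
  have hV : FunctionSpaces.Torus.IsSmooth (vecField ψc t) := by
    have : FunctionSpaces.Torus.lift (vecField ψc t) = fun y => WithLp.toLp 2 fun j => FunctionSpaces.Torus.lift (ψc j t) y := rfl
    show ContDiff ℝ ∞ (FunctionSpaces.Torus.lift (vecField ψc t))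
    rw [this]
    exact contDiff_piLp' (p := 2) fun j => hs j
  rw [PiLp.inner_apply]
  refine Finset.sum_congr rfl fun j _ => ?_
  rw [laplacian_apply_eq hV x j]
  simp [mul_comm, vecField]

end VecLaplacian

/-! ## One-dimensional Green identity and the resolved dissipation through slices -/

section Green

variable [DecidableEq d]

/-- `∫ a ∂ᵢ∂ᵢ b = -∫ ∂ᵢa ∂ᵢb` on `T^d` for smooth `a`, `b`. [folklore] -/
theorem integral_mul_partialDeriv_partialDeriv {a b : UnitAddTorus d → ℝ} (ha : FunctionSpaces.Torus.IsSmooth a)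
    (hb : FunctionSpaces.Torus.IsSmooth b) (i : d) :
    ∫ x, a x * FunctionSpaces.Torus.partialDeriv i (FunctionSpaces.Torus.partialDeriv i b) x =
      -∫ x, FunctionSpaces.Torus.partialDeriv i a x * FunctionSpaces.Torus.partialDeriv i b x := by
  have ha1 : FunctionSpaces.Torus.IsContDiff 1 a := ha.isContDiff (by simp)
  have hb1 : FunctionSpaces.Torus.IsContDiff 1 (FunctionSpaces.Torus.partialDeriv i b) := (hb.partialDeriv i).isContDiff (by simp)
  have hs : FunctionSpaces.Torus.IsSmooth (fun y => a y * FunctionSpaces.Torus.partialDeriv i b y) :=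
    (ContDiff.mul ha (hb.partialDeriv i) : FunctionSpaces.Torus.IsSmooth fun y => a y * FunctionSpaces.Torus.partialDeriv i b y)
  have hp : FunctionSpaces.Torus.IsSmooth (fun y => FunctionSpaces.Torus.partialDeriv i a y * FunctionSpaces.Torus.partialDeriv i b y) :=
    (ContDiff.mul (ha.partialDeriv i) (hb.partialDeriv i) :
      FunctionSpaces.Torus.IsSmooth fun y => FunctionSpaces.Torus.partialDeriv i a y * FunctionSpaces.Torus.partialDeriv i b y)
  have hpt : ∀ x, a x * FunctionSpaces.Torus.partialDeriv i (FunctionSpaces.Torus.partialDeriv i b) x =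
      FunctionSpaces.Torus.partialDeriv i (fun y => a y * FunctionSpaces.Torus.partialDeriv i b y) x -
        FunctionSpaces.Torus.partialDeriv i a x * FunctionSpaces.Torus.partialDeriv i b x := by
    intro x
    rw [FunctionSpaces.Torus.partialDeriv_mul ha1 hb1]
    ring
  simp_rw [hpt]
  rw [integral_sub (hs.partialDeriv i).integrable hp.integrable,
    FunctionSpaces.Torus.integral_partialDeriv_eq_zero_holds hs i, zero_sub]

/-- **The resolved dissipation through its slices** (for one time slice `v ∈ L¹`):
`∑ⱼᵢ ∫ vⱼ ((vⱼ ⋆ K) ⋆ ∂ᵢ∂ᵢK) = -‖∇(v ⋆ K)‖₂²` for `K = K_ε` (move the two derivatives across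
the outer mollification onto `vⱼ ⋆ K`, the even kernel onto `vⱼ`, and Green's identity). [folklore] -/
theorem sum_integral_mul_sliceL_eq_neg_gradNormSq {v : UnitAddTorus d → EuclideanSpace ℝ d}
    (hv : Integrable v volume) {ε : ℝ} (hε : 0 < ε) (hε' : ε ≤ 1 / 4) :
    ∑ j, ∑ i, ∫ x, v x j * (((fun y => v y j) ⋆ FunctionSpaces.Torus.kernel ε) ⋆
        FunctionSpaces.Torus.partialDeriv i (FunctionSpaces.Torus.partialDeriv i (FunctionSpaces.Torus.kernel ε))) x =
      -FunctionSpaces.Torus.gradNormSq (vecConv v (FunctionSpaces.Torus.kernel ε)) := by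
  have hKs : FunctionSpaces.Torus.IsSmooth (FunctionSpaces.Torus.kernel (d := d) ε) := FunctionSpaces.Torus.isSmooth_kernel hε hε'
  have hKc : Continuous (FunctionSpaces.Torus.kernel (d := d) ε) := hKs.continuous
  have hvj : ∀ j, Integrable (fun y => v y j) volume := fun j =>
    (EuclideanSpace.proj (𝕜 := ℝ) j).integrable_comp hv
  have hw : ∀ j, FunctionSpaces.Torus.IsSmooth ((fun y => v y j) ⋆ FunctionSpaces.Torus.kernel ε) := fun j =>
    FunctionSpaces.Torus.isSmooth_convolution (hvj j) hKs
  set V : UnitAddTorus d → EuclideanSpace ℝ d := vecConv v (FunctionSpaces.Torus.kernel ε) with hV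
  have hVs : FunctionSpaces.Torus.IsSmooth V := FunctionSpaces.Torus.isSmooth_vecMollify hv hε hε'
  have hV1 : FunctionSpaces.Torus.IsContDiff 1 V := hVs.isContDiff (by simp)
  have hVi : ∀ j, (fun y => V y j) = (fun y => v y j) ⋆ FunctionSpaces.Torus.kernel ε := fun j => rfl
  -- per pair `(j, i)`
  have hpair : ∀ j i, ∫ x, v x j * (((fun y => v y j) ⋆ FunctionSpaces.Torus.kernel ε) ⋆
      FunctionSpaces.Torus.partialDeriv i (FunctionSpaces.Torus.partialDeriv i (FunctionSpaces.Torus.kernel ε))) x =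
      -∫ x, (FunctionSpaces.Torus.partialDeriv i ((fun y => v y j) ⋆ FunctionSpaces.Torus.kernel ε) x) ^ 2 := by
    intro j i
    have h1 : ((fun y => v y j) ⋆ FunctionSpaces.Torus.kernel ε) ⋆
        FunctionSpaces.Torus.partialDeriv i (FunctionSpaces.Torus.partialDeriv i (FunctionSpaces.Torus.kernel ε)) =
        (FunctionSpaces.Torus.partialDeriv i (FunctionSpaces.Torus.partialDeriv i ((fun y => v y j) ⋆ FunctionSpaces.Torus.kernel ε))) ⋆
          FunctionSpaces.Torus.kernel ε := by
      funext x
      rw [FunctionSpaces.Torus.convolution_partialDeriv_right (hw j) (hKs.partialDeriv i) i x,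
        FunctionSpaces.Torus.convolution_partialDeriv_right ((hw j).partialDeriv i) hKs i x]
    rw [h1]
    have h2 := FunctionSpaces.Torus.integral_mul_convolution_comm (hvj j)
      (((hw j).partialDeriv i).partialDeriv i).integrable hKc (FunctionSpaces.Torus.kernel_neg hε hε')
    rw [h2, integral_mul_partialDeriv_partialDeriv (hw j) (hw j) i]
    congr 1
    refine integral_congr_ae (Eventually.of_forall fun x => ?_)
    ring
  simp_rw [hpair]
  -- the gradient norm in coordinates
  set L : d → d → UnitAddTorus d → ℝ := fun i j => FunctionSpaces.Torus.partialDeriv i (fun y => V y j) with hL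
  have hLc : ∀ i j, Continuous (L i j) := fun i j => ((hVs.apply j).partialDeriv i).continuous
  have hpt : ∀ x, ∑ i, ‖FunctionSpaces.Torus.partialDeriv i V x‖ ^ 2 = ∑ i, ∑ j, L i j x ^ 2 := by
    intro x
    refine Finset.sum_congr rfl fun i _ => ?_
    rw [EuclideanSpace.norm_sq_eq]
    refine Finset.sum_congr rfl fun j _ => ?_
    rw [Real.norm_eq_abs, sq_abs, partialDeriv_apply_eq hV1]
  have hint : ∀ i j, Integrable (fun x => L i j x ^ 2) volume := fun i j =>
    ((hLc i j).pow 2).integrable_unitAddTorus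
  unfold FunctionSpaces.Torus.gradNormSq
  simp_rw [hpt]
  rw [integral_finsetSum _ fun i _ => integrable_finsetSum _ fun j _ => hint i j]
  simp_rw [integral_finsetSum _ fun j _ => hint _ j]
  rw [Finset.sum_comm, ← Finset.sum_neg_distrib]
  refine Finset.sum_congr rfl fun i _ => ?_
  rw [← Finset.sum_neg_distrib]
  refine Finset.sum_congr rfl fun j _ => ?_
  simp only [hL, hVi j]

omit [DecidableEq d] in
/-- **The force pairing through its slices** (one time slice, `v, g ∈ L¹`):
`∑ⱼ ∫ gⱼ ((vⱼ ⋆ K) ⋆ K) = ∫ ⟪g ⋆ K, v ⋆ K⟫` for the even kernel `K = K_ε`. [folklore] -/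
theorem sum_integral_mul_sliceC_eq_integral_inner {v g : UnitAddTorus d → EuclideanSpace ℝ d}
    (hv : Integrable v volume) (hg : Integrable g volume) {ε : ℝ} (hε : 0 < ε) (hε' : ε ≤ 1 / 4) :
    ∑ j, ∫ x, g x j * (((fun y => v y j) ⋆ FunctionSpaces.Torus.kernel ε) ⋆ FunctionSpaces.Torus.kernel ε) x =
      ∫ x, ⟪vecConv g (FunctionSpaces.Torus.kernel ε) x, vecConv v (FunctionSpaces.Torus.kernel ε) x⟫_ℝ := by
  have hKs : FunctionSpaces.Torus.IsSmooth (FunctionSpaces.Torus.kernel (d := d) ε) := FunctionSpaces.Torus.isSmooth_kernel hε hε'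
  have hKc : Continuous (FunctionSpaces.Torus.kernel (d := d) ε) := hKs.continuous
  have hvj : ∀ j, Integrable (fun y => v y j) volume := fun j => (EuclideanSpace.proj (𝕜 := ℝ) j).integrable_comp hv
  have hgj : ∀ j, Integrable (fun y => g y j) volume := fun j => (EuclideanSpace.proj (𝕜 := ℝ) j).integrable_comp hg
  have hw : ∀ j, Continuous ((fun y => v y j) ⋆ FunctionSpaces.Torus.kernel ε) := fun j =>
    FunctionSpaces.Torus.continuous_convolution (hvj j) hKc
  have hwg : ∀ j, Continuous ((fun y => g y j) ⋆ FunctionSpaces.Torus.kernel ε) := fun j =>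
    FunctionSpaces.Torus.continuous_convolution (hgj j) hKc
  have hpair : ∀ j, ∫ x, g x j * (((fun y => v y j) ⋆ FunctionSpaces.Torus.kernel ε) ⋆ FunctionSpaces.Torus.kernel ε) x =
      ∫ x, ((fun y => g y j) ⋆ FunctionSpaces.Torus.kernel ε) x * ((fun y => v y j) ⋆ FunctionSpaces.Torus.kernel ε) x := fun j =>
    FunctionSpaces.Torus.integral_mul_convolution_comm (hgj j) (hw j).integrable_unitAddTorus hKc
      (FunctionSpaces.Torus.kernel_neg hε hε')
  simp_rw [hpair]
  have hint : ∀ j, Integrable (fun x => ((fun y => g y j) ⋆ FunctionSpaces.Torus.kernel ε) x *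
      ((fun y => v y j) ⋆ FunctionSpaces.Torus.kernel ε) x) volume := fun j =>
    ((hwg j).mul (hw j)).integrable_unitAddTorus
  rw [← integral_finsetSum _ fun j _ => hint j]
  refine integral_congr_ae (Eventually.of_forall fun x => ?_)
  show ∑ j, ((fun y => g y j) ⋆ FunctionSpaces.Torus.kernel ε) x * ((fun y => v y j) ⋆ FunctionSpaces.Torus.kernel ε) x =
    ⟪vecConv g (FunctionSpaces.Torus.kernel ε) x, vecConv v (FunctionSpaces.Torus.kernel ε) x⟫_ℝ
  rw [inner_eq_sum_mul]
  rfl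

end Green

/-! ## Pairings converge along `L²` convergence -/

section PairingTwo

variable {α : Type*} [MeasurableSpace α] {μ : Measure α}

/-- **Pairings converge along `L²` convergence**: if `gᵢ → g₀` in `L²` and `f ∈ L²`, then
`∫ f gᵢ → ∫ f g₀`. [folklore] -/
theorem tendsto_integral_mul_of_tendsto_eLpNorm_two {ι : Type*} {l : Filter ι} {f : α → ℝ}
    {g : ι → α → ℝ} {g₀ : α → ℝ} (hf : MemLp f 2 μ) (hg : ∀ i, AEStronglyMeasurable (g i) μ)
    (hg₀ : MemLp g₀ 2 μ) (h : Tendsto (fun i => eLpNorm (fun x => g i x - g₀ x) 2 μ) l (𝓝 0)) :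
    Tendsto (fun i => ∫ x, f x * g i x ∂μ) l (𝓝 (∫ x, f x * g₀ x ∂μ)) := by
  have hfg₀ : Integrable (fun x => f x * g₀ x) μ := hf.integrable_mul hg₀
  have hb : Tendsto (fun i => (ENNReal.ofReal 1 * eLpNorm f 2 μ * eLpNorm (fun x => g i x - g₀ x) 2 μ).toReal)
      l (𝓝 0) := by
    have h1 := ENNReal.Tendsto.const_mul h (Or.inr (ENNReal.mul_ne_top ENNReal.ofReal_ne_top hf.eLpNorm_ne_top))
      (a := ENNReal.ofReal 1 * eLpNorm f 2 μ)
    rw [mul_zero] at h1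
    have h2 := (ENNReal.tendsto_toReal ENNReal.zero_ne_top).comp h1
    rwa [ENNReal.toReal_zero] at h2
  rw [tendsto_iff_norm_sub_tendsto_zero]
  refine squeeze_zero' (Eventually.of_forall fun i => norm_nonneg _) ?_ hb
  filter_upwards [h.eventually (Iio_mem_nhds ENNReal.zero_lt_top)] with i hi
  have hdiff : MemLp (fun x => g i x - g₀ x) 2 μ := ⟨(hg i).sub hg₀.aestronglyMeasurable, hi⟩
  have hfd : Integrable (fun x => f x * (g i x - g₀ x)) μ := hf.integrable_mul hdiff
  have hfgi : Integrable (fun x => f x * g i x) μ := by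
    have := hfd.add hfg₀
    refine this.congr (Eventually.of_forall fun x => ?_)
    simp only [Pi.add_apply]
    ring
  rw [← integral_sub hfgi hfg₀]
  have heq : (fun x => f x * g i x - f x * g₀ x) = fun x => (1 : ℝ) * f x * (g i x - g₀ x) := by
    funext x; ring
  rw [heq]
  have hfin : ENNReal.ofReal 1 * eLpNorm f 2 μ * eLpNorm (fun x => g i x - g₀ x) 2 μ ≠ ⊤ :=
    ENNReal.mul_ne_top (ENNReal.mul_ne_top ENNReal.ofReal_ne_top hf.eLpNorm_ne_top) hi.ne
  have := enorm_integral_mul_mul_le_two_two (a := fun _ => (1 : ℝ)) (C := 1) (fun _ => by simp)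
    hf.aestronglyMeasurable hdiff.aestronglyMeasurable (μ := μ)
  rw [← ofReal_norm] at this
  exact (ENNReal.ofReal_le_iff_le_toReal hfin).1 this

end PairingTwo


/-! ## The test field, its Laplacian and itself as iterated time mollifications -/

section TestFieldMore

variable [DecidableEq d] {ρ θ : ℝ → ℝ} {K : UnitAddTorus d → ℝ} {U : ℝ × UnitAddTorus d → ℝ}

omit [DecidableEq d] in
/-- **A cut-off space–time mollification as an iterated time mollification**: for any continuous
space kernel `k'`,
`stConv ρ k' (θ ⊗ stConv ρ K U) (t, x) = (ρ ⋆ₜ (s ↦ θ(s) (ρ ⋆ₜ B(·, x))(s)))(t)` with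
`B(r, x) = (w(r, ·) ⋆ k')(x)`, `w = sliceConv U K` (the common shape of `partialDeriv_cetTest_eq`,
of the test field itself, `k' = K`, and of its Laplacian, `k' = ∂ᵢ∂ᵢK`). [folklore] -/
theorem stConv_cutoff_eq_iteratedTimeConv (hUm : StronglyMeasurable U)
    (hU : Integrable U ((volume : Measure ℝ).prod volume)) (hρ : ContDiff ℝ ∞ ρ)
    (hρc : HasCompactSupport ρ) (hK : FunctionSpaces.Torus.IsSmooth K) (hθ : ContDiff ℝ ∞ θ) (hθc : HasCompactSupport θ)
    {k' : UnitAddTorus d → ℝ} (hk' : Continuous k') (t : ℝ) (x : UnitAddTorus d) :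
    FunctionSpaces.Torus.stConv ρ k' (fun p => θ p.1 * FunctionSpaces.Torus.stConv ρ K U p.1 p.2) t x =
      (ρ ⋆ fun s => θ s * (ρ ⋆ fun r => ((sliceConv U K r) ⋆ k') x) s) t := by
  have hG := integrable_cutoff_stConv hU hρ hρc hK hθ hθc
  rw [FunctionSpaces.Torus.stConv_eq_timeConv hG hρ.continuous hρc hk']
  congr 1
  funext s
  have hsm : ((fun z => θ s * FunctionSpaces.Torus.stConv ρ K U s z) ⋆ k') x =
      θ s * ((FunctionSpaces.Torus.stConv ρ K U s) ⋆ k') x := by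
    simp only [convolution_lsmul, smul_eq_mul, mul_assoc]
    exact integral_const_mul _ _
  rw [hsm, stConv_eq_timeConv_sliceConv hU hρ.continuous hρc hK.continuous s,
    ← FunctionSpaces.Torus.timeConv_spaceConv_comm (integrable_uncurry_sliceConv hUm hU hK.continuous) hρ.continuous hρc hk']

omit [DecidableEq d] in
/-- **The test field as an iterated time mollification**:
`ψ(t, x) = (ρ ⋆ₜ (s ↦ θ(s) (ρ ⋆ₜ C(·, x))(s)))(t)` with `C(r, x) = (w(r, ·) ⋆ K)(x)`. [folklore] -/
theorem cetTest_eq_iteratedTimeConv (hUm : StronglyMeasurable U)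
    (hU : Integrable U ((volume : Measure ℝ).prod volume)) (hρ : ContDiff ℝ ∞ ρ)
    (hρc : HasCompactSupport ρ) (hK : FunctionSpaces.Torus.IsSmooth K) (hθ : ContDiff ℝ ∞ θ) (hθc : HasCompactSupport θ)
    (t : ℝ) (x : UnitAddTorus d) :
    cetTest ρ K θ U t x = (ρ ⋆ fun s => θ s * (ρ ⋆ fun r => ((sliceConv U K r) ⋆ K) x) s) t :=
  stConv_cutoff_eq_iteratedTimeConv hUm hU hρ hρc hK hθ hθc hK.continuous t x

/-- **The Laplacian of the test field as a sum of iterated time mollifications**: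
`Δψ(t, x) = ∑ᵢ (ρ ⋆ₜ (s ↦ θ(s) (ρ ⋆ₜ Lᵢ(·, x))(s)))(t)` with `Lᵢ(r, x) = (w(r, ·) ⋆ ∂ᵢ∂ᵢK)(x)`. [folklore] -/
theorem laplacian_cetTest_eq (hUm : StronglyMeasurable U)
    (hU : Integrable U ((volume : Measure ℝ).prod volume)) (hρ : ContDiff ℝ ∞ ρ)
    (hρc : HasCompactSupport ρ) (hK : FunctionSpaces.Torus.IsSmooth K) (hθ : ContDiff ℝ ∞ θ) (hθc : HasCompactSupport θ)
    (t : ℝ) (x : UnitAddTorus d) :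
    FunctionSpaces.Torus.laplacian (cetTest ρ K θ U t) x =
      ∑ i, (ρ ⋆ fun s => θ s * (ρ ⋆ fun r => ((sliceConv U K r) ⋆
        FunctionSpaces.Torus.partialDeriv i (FunctionSpaces.Torus.partialDeriv i K)) x) s) t := by
  have hρ1 : ContDiff ℝ 1 ρ := hρ.of_le (by norm_cast)
  have hK1 : FunctionSpaces.Torus.IsContDiff 1 K := hK.isContDiff (by simp)
  have hG := integrable_cutoff_stConv hU hρ hρc hK hθ hθc
  have hslice : FunctionSpaces.Torus.IsSmooth (cetTest ρ K θ U t) :=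
    isSmooth_slice_of_contDiff_stLift (contDiff_stLift_cetTest hU hρ hρc hK hθ hθc) t
  rw [FunctionSpaces.Torus.laplacian_eq_sum_partialDeriv_partialDeriv hslice]
  refine Finset.sum_congr rfl fun i _ => ?_
  have h1 : FunctionSpaces.Torus.partialDeriv i (cetTest ρ K θ U t) =
      FunctionSpaces.Torus.stConv ρ (FunctionSpaces.Torus.partialDeriv i K) (fun p => θ p.1 * FunctionSpaces.Torus.stConv ρ K U p.1 p.2) t := by
    funext y
    exact FunctionSpaces.Torus.partialDeriv_stConv hG hρ1 hρc hK1 i t y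
  rw [h1, FunctionSpaces.Torus.partialDeriv_stConv hG hρ1 hρc ((hK.partialDeriv i).isContDiff (by simp)) i t x]
  exact stConv_cutoff_eq_iteratedTimeConv hUm hU hρ hρc hK hθ hθc (((hK.partialDeriv i).partialDeriv i).continuous) t x

end TestFieldMore

/-! ## The forced Navier–Stokes weak formulation tested with the mollified field -/

section WeakFormNS

variable [DecidableEq d] {T ν : ℝ} {u f : ℝ → UnitAddTorus d → EuclideanSpace ℝ d}
  {Uc Fc : d → ℝ × UnitAddTorus d → ℝ} {ψc : d → ℝ → UnitAddTorus d → ℝ}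

/-- **The forced weak Navier–Stokes identity, tested with a vector field of smooth bounded
components compactly supported in `(0,T)`, read on `ℝ × T^d` against the extended velocity and
force.** If `ψ = vecField ψc` satisfies
`∫₀ᵀ∫ (⟪u, ∂ₜψ⟫ + ⟪u, (u·∇)ψ⟫ + ν⟪u, Δψ⟫ + ⟪f, ψ⟫) = 0`, the components being smooth with
bounded, jointly continuous `∂ₜψⱼ`, `∂ᵢψⱼ`, `Δψⱼ`, `ψⱼ`, then for strongly measurable
representatives `Uⱼ`, `Fⱼ` of the components of `ū = 𝟙_{(0,T)} u`, `f̄ = 𝟙_{(0,T)} f`: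
`∑ⱼ ∫ Uⱼ ∂ₜψⱼ + ∑ⱼᵢ ∫ Uⱼ Uᵢ ∂ᵢψⱼ + ν ∑ⱼ ∫ Uⱼ Δψⱼ + ∑ⱼ ∫ Fⱼ ψⱼ = 0` (integrals over `ℝ × T^d`). [folklore] -/
theorem weakFormNS_rewrite
    (hweak : ∫ t in Ioo 0 T, ∫ x, (⟪u t x, FunctionSpaces.Torus.timeDeriv (vecField ψc) t x⟫_ℝ +
      ⟪u t x, FunctionSpaces.Torus.convect (u t) (vecField ψc t) x⟫_ℝ +
        ν * ⟪u t x, FunctionSpaces.Torus.laplacian (vecField ψc t) x⟫_ℝ + ⟪f t x, vecField ψc t x⟫_ℝ) = 0)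
    (hψs : ∀ j, ContDiff ℝ ∞ (FunctionSpaces.Torus.stLift (ψc j)))
    (hdtc : ∀ j, Continuous (uncurry (FunctionSpaces.Torus.timeDeriv (ψc j))))
    (hdxc : ∀ j i, Continuous (uncurry fun t x => FunctionSpaces.Torus.partialDeriv i (ψc j t) x))
    (hdLc : ∀ j, Continuous (uncurry fun t x => FunctionSpaces.Torus.laplacian (ψc j t) x))
    (hdtb : ∀ j, ∃ C, ∀ t x, |FunctionSpaces.Torus.timeDeriv (ψc j) t x| ≤ C)
    (hdxb : ∀ j i, ∃ C, ∀ t x, |FunctionSpaces.Torus.partialDeriv i (ψc j t) x| ≤ C)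
    (hdLb : ∀ j, ∃ C, ∀ t x, |FunctionSpaces.Torus.laplacian (ψc j t) x| ≤ C)
    (hψb : ∀ j, ∃ C, ∀ t x, |ψc j t x| ≤ C)
    (hbar1 : Integrable (stBar T u) ((volume : Measure ℝ).prod volume))
    (hbar2 : MemLp (stBar T u) 2 ((volume : Measure ℝ).prod volume))
    (hfbar1 : Integrable (stBar T f) ((volume : Measure ℝ).prod volume))
    (hUc : ∀ j, Uc j =ᵐ[(volume : Measure ℝ).prod volume] fun q => stBar T u q j)
    (hFc : ∀ j, Fc j =ᵐ[(volume : Measure ℝ).prod volume] fun q => stBar T f q j) :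
    ∑ j, ∫ q, Uc j q * FunctionSpaces.Torus.timeDeriv (ψc j) q.1 q.2 ∂((volume : Measure ℝ).prod volume) +
      ∑ j, ∑ i, ∫ q, Uc j q * Uc i q * FunctionSpaces.Torus.partialDeriv i (ψc j q.1) q.2
        ∂((volume : Measure ℝ).prod volume) +
      ν * ∑ j, ∫ q, Uc j q * FunctionSpaces.Torus.laplacian (ψc j q.1) q.2 ∂((volume : Measure ℝ).prod volume) +
      ∑ j, ∫ q, Fc j q * ψc j q.1 q.2 ∂((volume : Measure ℝ).prod volume) = 0 := by
  set μ : Measure (ℝ × UnitAddTorus d) := (volume : Measure ℝ).prod volume with hμ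
  -- (a) the integrand, componentwise
  have hslice : ∀ j t, FunctionSpaces.Torus.IsSmooth (ψc j t) := fun j t => isSmooth_slice_of_contDiff_stLift (hψs j) t
  have hdiff : ∀ t x j, DifferentiableAt ℝ (fun τ => ψc j τ x) t := by
    intro t x j
    obtain ⟨y, rfl⟩ := FunctionSpaces.Torus.proj_surjective x
    have h : (fun τ => ψc j τ (FunctionSpaces.Torus.proj y)) = FunctionSpaces.Torus.stLift (ψc j) ∘ fun τ => (τ, y) := rfl
    rw [h]
    exact (((hψs j).differentiable (by simp)).comp
      ((differentiable_id.prodMk (differentiable_const y)))).differentiableAt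
  have hpt : ∀ t x, ⟪u t x, FunctionSpaces.Torus.timeDeriv (vecField ψc) t x⟫_ℝ +
      ⟪u t x, FunctionSpaces.Torus.convect (u t) (vecField ψc t) x⟫_ℝ +
        ν * ⟪u t x, FunctionSpaces.Torus.laplacian (vecField ψc t) x⟫_ℝ + ⟪f t x, vecField ψc t x⟫_ℝ =
      ∑ j, u t x j * FunctionSpaces.Torus.timeDeriv (ψc j) t x +
        ∑ j, ∑ i, u t x j * u t x i * FunctionSpaces.Torus.partialDeriv i (ψc j t) x +
        ν * ∑ j, u t x j * FunctionSpaces.Torus.laplacian (ψc j t) x + ∑ j, f t x j * ψc j t x := by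
    intro t x
    rw [inner_timeDeriv_vecField (hdiff t x), inner_convect_vecField (fun j => (hslice j t).isContDiff (by simp)),
      inner_laplacian_vecField (fun j => hslice j t)]
    have hF : ⟪f t x, vecField ψc t x⟫_ℝ = ∑ j, f t x j * ψc j t x := by
      rw [inner_eq_sum_mul]; rfl
    rw [hF]
    congr 1
    congr 1
    congr 1
    refine Finset.sum_congr rfl fun j _ => ?_
    rw [Finset.mul_sum]
    refine Finset.sum_congr rfl fun i _ => ?_
    ring
  -- (b) the same expression with the extended fields, on `ℝ × T^d`
  set Fb : ℝ × UnitAddTorus d → ℝ := fun q => ∑ j, stBar T u q j * FunctionSpaces.Torus.timeDeriv (ψc j) q.1 q.2 +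
    ∑ j, ∑ i, stBar T u q j * stBar T u q i * FunctionSpaces.Torus.partialDeriv i (ψc j q.1) q.2 +
    ν * ∑ j, stBar T u q j * FunctionSpaces.Torus.laplacian (ψc j q.1) q.2 +
    ∑ j, stBar T f q j * ψc j q.1 q.2 with hFb
  have hbarj : ∀ j, Integrable (fun q => stBar T u q j) μ := fun j =>
    (EuclideanSpace.proj (𝕜 := ℝ) j).integrable_comp hbar1
  have hfbarj : ∀ j, Integrable (fun q => stBar T f q j) μ := fun j =>
    (EuclideanSpace.proj (𝕜 := ℝ) j).integrable_comp hfbar1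
  have hbarj2 : ∀ j, MemLp (fun q => stBar T u q j) 2 μ := fun j => hbar2.eval_piLp j
  have hdtm : ∀ j, AEStronglyMeasurable (fun q : ℝ × UnitAddTorus d => FunctionSpaces.Torus.timeDeriv (ψc j) q.1 q.2) μ :=
    fun j => (hdtc j).aestronglyMeasurable
  have hdxm : ∀ j i, AEStronglyMeasurable
      (fun q : ℝ × UnitAddTorus d => FunctionSpaces.Torus.partialDeriv i (ψc j q.1) q.2) μ := fun j i => (hdxc j i).aestronglyMeasurable
  have hdLm : ∀ j, AEStronglyMeasurable
      (fun q : ℝ × UnitAddTorus d => FunctionSpaces.Torus.laplacian (ψc j q.1) q.2) μ := fun j => (hdLc j).aestronglyMeasurable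
  have hψm : ∀ j, AEStronglyMeasurable (fun q : ℝ × UnitAddTorus d => ψc j q.1 q.2) μ := fun j =>
    (FunctionSpaces.Torus.continuous_uncurry_of_continuous_stLift (hψs j).continuous).aestronglyMeasurable
  have hA : ∀ j, Integrable (fun q => stBar T u q j * FunctionSpaces.Torus.timeDeriv (ψc j) q.1 q.2) μ := fun j => by
    obtain ⟨C, hC⟩ := hdtb j
    exact (hbarj j).mul_bdd (hdtm j) (Eventually.of_forall fun q => by
      rw [Real.norm_eq_abs]; exact hC _ _)
  have hB : ∀ j i, Integrable (fun q => stBar T u q j * stBar T u q i * FunctionSpaces.Torus.partialDeriv i (ψc j q.1) q.2) μ :=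
    fun j i => by
    obtain ⟨C, hC⟩ := hdxb j i
    exact ((hbarj2 j).integrable_mul (hbarj2 i)).mul_bdd (hdxm j i)
      (Eventually.of_forall fun q => by rw [Real.norm_eq_abs]; exact hC _ _)
  have hCL : ∀ j, Integrable (fun q => stBar T u q j * FunctionSpaces.Torus.laplacian (ψc j q.1) q.2) μ := fun j => by
    obtain ⟨C, hC⟩ := hdLb j
    exact (hbarj j).mul_bdd (hdLm j) (Eventually.of_forall fun q => by
      rw [Real.norm_eq_abs]; exact hC _ _)
  have hD : ∀ j, Integrable (fun q => stBar T f q j * ψc j q.1 q.2) μ := fun j => by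
    obtain ⟨C, hC⟩ := hψb j
    exact (hfbarj j).mul_bdd (hψm j) (Eventually.of_forall fun q => by
      rw [Real.norm_eq_abs]; exact hC _ _)
  have hFbi : Integrable Fb μ :=
    (((integrable_finsetSum _ fun j _ => hA j).add
      (integrable_finsetSum _ fun j _ => integrable_finsetSum _ fun i _ => hB j i)).add
      ((integrable_finsetSum _ fun j _ => hCL j).const_mul ν)).add (integrable_finsetSum _ fun j _ => hD j)
  -- (c) from the weak identity to `∫ Fb = 0`
  have hzero : ∫ q, Fb q ∂μ = 0 := by
    rw [integral_prod _ hFbi]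
    have h1 : ∫ t, ∫ x, Fb (t, x) = ∫ t in Ioo 0 T, ∫ x, Fb (t, x) := by
      refine (setIntegral_eq_integral_of_forall_compl_eq_zero fun t ht => ?_).symm
      have : (fun x => Fb (t, x)) = fun _ => 0 := by
        funext x
        simp [hFb, stBar_apply_of_not_mem ht]
      rw [this, integral_zero]
    rw [h1]
    have h2 : ∫ t in Ioo 0 T, ∫ x, Fb (t, x) = ∫ t in Ioo 0 T, ∫ x, (⟪u t x, FunctionSpaces.Torus.timeDeriv (vecField ψc) t x⟫_ℝ +
        ⟪u t x, FunctionSpaces.Torus.convect (u t) (vecField ψc t) x⟫_ℝ +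
          ν * ⟪u t x, FunctionSpaces.Torus.laplacian (vecField ψc t) x⟫_ℝ + ⟪f t x, vecField ψc t x⟫_ℝ) := by
      refine setIntegral_congr_fun measurableSet_Ioo fun t ht => ?_
      refine integral_congr_ae (Eventually.of_forall fun x => ?_)
      show Fb (t, x) = ⟪u t x, FunctionSpaces.Torus.timeDeriv (vecField ψc) t x⟫_ℝ +
        ⟪u t x, FunctionSpaces.Torus.convect (u t) (vecField ψc t) x⟫_ℝ +
          ν * ⟪u t x, FunctionSpaces.Torus.laplacian (vecField ψc t) x⟫_ℝ + ⟪f t x, vecField ψc t x⟫_ℝ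
      rw [hpt t x]
      simp [hFb, stBar_apply_of_mem ht]
    rw [h2]
    exact hweak
  -- (d) replace the extended fields by their representatives and split
  have hae : ∀ᵐ q ∂μ, ∀ j, Uc j q = stBar T u q j := ae_all_iff.2 fun j => hUc j
  have haeF : ∀ᵐ q ∂μ, ∀ j, Fc j q = stBar T f q j := ae_all_iff.2 fun j => hFc j
  have hA' : ∀ j, Integrable (fun q => Uc j q * FunctionSpaces.Torus.timeDeriv (ψc j) q.1 q.2) μ := fun j =>
    (hA j).congr (hae.mono fun q hq => by simp only [hq j])
  have hB' : ∀ j i, Integrable (fun q => Uc j q * Uc i q * FunctionSpaces.Torus.partialDeriv i (ψc j q.1) q.2) μ :=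
    fun j i => (hB j i).congr (hae.mono fun q hq => by simp only [hq j, hq i])
  have hCL' : ∀ j, Integrable (fun q => Uc j q * FunctionSpaces.Torus.laplacian (ψc j q.1) q.2) μ := fun j =>
    (hCL j).congr (hae.mono fun q hq => by simp only [hq j])
  have hD' : ∀ j, Integrable (fun q => Fc j q * ψc j q.1 q.2) μ := fun j =>
    (hD j).congr (haeF.mono fun q hq => by simp only [hq j])
  have hFb' : ∫ q, Fb q ∂μ = ∫ q, (∑ j, Uc j q * FunctionSpaces.Torus.timeDeriv (ψc j) q.1 q.2 +
      ∑ j, ∑ i, Uc j q * Uc i q * FunctionSpaces.Torus.partialDeriv i (ψc j q.1) q.2 +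
      ν * ∑ j, Uc j q * FunctionSpaces.Torus.laplacian (ψc j q.1) q.2 +
      ∑ j, Fc j q * ψc j q.1 q.2) ∂μ := by
    refine integral_congr_ae ?_
    filter_upwards [hae, haeF] with q hq hqF
    simp only [hFb, hq, hqF]
  rw [hzero] at hFb'
  rw [integral_add, integral_add, integral_add] at hFb'
  · rw [integral_finsetSum _ fun j _ => hA' j,
      integral_finsetSum _ fun j _ => integrable_finsetSum _ fun i _ => hB' j i,
      integral_const_mul, integral_finsetSum _ fun j _ => hCL' j,
      integral_finsetSum _ fun j _ => hD' j] at hFb'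
    simp_rw [integral_finsetSum _ fun i _ => hB' _ i] at hFb'
    exact hFb'.symm
  · exact integrable_finsetSum _ fun j _ => hA' j
  · exact integrable_finsetSum _ fun j _ => integrable_finsetSum _ fun i _ => hB' j i
  · exact (integrable_finsetSum _ fun j _ => hA' j).add
      (integrable_finsetSum _ fun j _ => integrable_finsetSum _ fun i _ => hB' j i)
  · exact (integrable_finsetSum _ fun j _ => hCL' j).const_mul ν
  · exact ((integrable_finsetSum _ fun j _ => hA' j).add
      (integrable_finsetSum _ fun j _ => integrable_finsetSum _ fun i _ => hB' j i)).add
      ((integrable_finsetSum _ fun j _ => hCL' j).const_mul ν)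
  · exact integrable_finsetSum _ fun j _ => hD' j

end WeakFormNS


/-! ## Identifications of the viscous and force limits -/

section IdentifyNS

variable [DecidableEq d] {T : ℝ} {u f : ℝ → UnitAddTorus d → EuclideanSpace ℝ d}
  {Uc Fc : d → ℝ × UnitAddTorus d → ℝ} {θ : ℝ → ℝ}

/-- **Identification of the viscous limit**: with `Lⱼᵢ(t,x) = ((wⱼ(t,·)) ⋆ ∂ᵢ∂ᵢK)(x)`,
`wⱼ = sliceConv Uⱼ K`, `K = K_ε`, and `Uⱼ` a.e. equal to the components of the extended field,
`∑ⱼᵢ ∫ Uⱼ θ Lⱼᵢ = -∫_{(0,T)} θ(t) ‖∇(u(t) ⋆ K)‖₂² dt`. [folklore] -/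
theorem integral_sum_mul_cutoff_sliceL_eq (hθT : tsupport θ ⊆ Ioo 0 T)
    (hUc : ∀ j, Uc j =ᵐ[(volume : Measure ℝ).prod volume] fun q => stBar T u q j)
    (hL1 : ∀ᵐ t ∂(volume.restrict (Ioo 0 T)), Integrable (u t) volume) {ε : ℝ} (hε : 0 < ε)
    (hε' : ε ≤ 1 / 4)
    (hint : ∀ j i, Integrable (fun q : ℝ × UnitAddTorus d => Uc j q *
      (θ q.1 * ((sliceConv (Uc j) (FunctionSpaces.Torus.kernel ε) q.1) ⋆
        FunctionSpaces.Torus.partialDeriv i (FunctionSpaces.Torus.partialDeriv i (FunctionSpaces.Torus.kernel ε))) q.2))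
      ((volume : Measure ℝ).prod volume)) :
    ∑ j, ∑ i, ∫ q, Uc j q *
        (θ q.1 * ((sliceConv (Uc j) (FunctionSpaces.Torus.kernel ε) q.1) ⋆
          FunctionSpaces.Torus.partialDeriv i (FunctionSpaces.Torus.partialDeriv i (FunctionSpaces.Torus.kernel ε))) q.2)
        ∂((volume : Measure ℝ).prod volume) =
      -∫ t in Ioo 0 T, θ t * FunctionSpaces.Torus.gradNormSq (vecConv (u t) (FunctionSpaces.Torus.kernel ε)) := by
  set μ : Measure (ℝ × UnitAddTorus d) := (volume : Measure ℝ).prod volume with hμ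
  set g : d → d → ℝ × UnitAddTorus d → ℝ := fun j i q => Uc j q *
    (θ q.1 * ((sliceConv (Uc j) (FunctionSpaces.Torus.kernel ε) q.1) ⋆
      FunctionSpaces.Torus.partialDeriv i (FunctionSpaces.Torus.partialDeriv i (FunctionSpaces.Torus.kernel ε))) q.2) with hg
  have hsum : ∑ j, ∑ i, ∫ q, g j i q ∂μ = ∫ q, ∑ j, ∑ i, g j i q ∂μ := by
    rw [integral_finsetSum _ fun j _ => integrable_finsetSum _ fun i _ => hint j i]
    refine Finset.sum_congr rfl fun j _ => ?_
    rw [integral_finsetSum _ fun i _ => hint j i]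
  have hintsum : Integrable (fun q => ∑ j, ∑ i, g j i q) μ :=
    integrable_finsetSum _ fun j _ => integrable_finsetSum _ fun i _ => hint j i
  rw [show (∑ j, ∑ i, ∫ q, Uc j q *
      (θ q.1 * ((sliceConv (Uc j) (FunctionSpaces.Torus.kernel ε) q.1) ⋆
        FunctionSpaces.Torus.partialDeriv i (FunctionSpaces.Torus.partialDeriv i (FunctionSpaces.Torus.kernel ε))) q.2) ∂μ) =
      ∑ j, ∑ i, ∫ q, g j i q ∂μ from rfl, hsum, integral_prod _ hintsum,
    ← integral_neg, ← integral_indicator measurableSet_Ioo]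
  have hslint : ∀ᵐ t ∂(volume : Measure ℝ), ∀ j i, Integrable (fun x => g j i (t, x)) volume := by
    have h : ∀ j i, ∀ᵐ t ∂(volume : Measure ℝ), Integrable (fun x => g j i (t, x)) volume :=
      fun j i => (hint j i).prod_right_ae
    exact ae_all_iff.2 fun j => ae_all_iff.2 fun i => h j i
  have hL1' : ∀ᵐ t ∂(volume : Measure ℝ), t ∈ Ioo 0 T → Integrable (u t) volume :=
    (ae_restrict_iff' measurableSet_Ioo).1 hL1
  refine integral_congr_ae ?_
  filter_upwards [ae_slice_eq_of_ae_eq_stBar hUc, hL1', hslint] with t hs htL1 htint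
  by_cases hmem : t ∈ Ioo 0 T
  · rw [indicator_of_mem hmem]
    have hv := htL1 hmem
    have hslice : ∀ j, (fun y => Uc j (t, y)) =ᵐ[volume] fun y => u t y j := fun j => by
      filter_upwards [hs j] with y hy
      rw [hy, stBar_apply_of_mem hmem]
    have hw : ∀ j, sliceConv (Uc j) (FunctionSpaces.Torus.kernel ε) t = (fun y => u t y j) ⋆ FunctionSpaces.Torus.kernel ε := fun j =>
      FunctionSpaces.Torus.convolution_congr_ae_left (ContinuousLinearMap.lsmul ℝ ℝ) (hslice j) _
    have hfi : ∀ j i, (fun x => g j i (t, x)) =ᵐ[volume] fun x => θ t * (u t x j *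
        (((fun y => u t y j) ⋆ FunctionSpaces.Torus.kernel ε) ⋆
          FunctionSpaces.Torus.partialDeriv i (FunctionSpaces.Torus.partialDeriv i (FunctionSpaces.Torus.kernel ε))) x) := by
      intro j i
      filter_upwards [hslice j] with x hxj
      simp only [hg, hw j]
      rw [show Uc j (t, x) = u t x j from hxj]
      ring
    rw [integral_finsetSum _ fun j _ => integrable_finsetSum _ fun i _ => htint j i]
    simp_rw [integral_finsetSum _ fun i _ => htint _ i]
    have h2 : ∀ j i, ∫ x, g j i (t, x) = θ t * ∫ x, u t x j *
        (((fun y => u t y j) ⋆ FunctionSpaces.Torus.kernel ε) ⋆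
          FunctionSpaces.Torus.partialDeriv i (FunctionSpaces.Torus.partialDeriv i (FunctionSpaces.Torus.kernel ε))) x := fun j i => by
      rw [integral_congr_ae (hfi j i), integral_const_mul]
    simp_rw [h2, ← Finset.mul_sum]
    rw [sum_integral_mul_sliceL_eq_neg_gradNormSq hv hε hε']
    ring
  · rw [indicator_of_notMem hmem]
    have hθ0 : θ t = 0 := image_eq_zero_of_notMem_tsupport fun h => hmem (hθT h)
    have : (fun x => ∑ j, ∑ i, g j i (t, x)) = fun _ => 0 := by
      funext x
      simp [hg, hθ0]
    rw [this, integral_zero]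

omit [DecidableEq d] in
/-- **Identification of the force limit**: with `Cⱼ(t,x) = ((wⱼ(t,·)) ⋆ K)(x)`,
`wⱼ = sliceConv Uⱼ K`, `K = K_ε`, and `Uⱼ`, `Fⱼ` a.e. equal to the components of the extended
velocity and force, `∑ⱼ ∫ Fⱼ θ Cⱼ = ∫_{(0,T)} θ(t) ∫ ⟪f(t) ⋆ K, u(t) ⋆ K⟫ dt`. [folklore] -/
theorem integral_sum_mul_cutoff_sliceC_eq (hθT : tsupport θ ⊆ Ioo 0 T)
    (hUc : ∀ j, Uc j =ᵐ[(volume : Measure ℝ).prod volume] fun q => stBar T u q j)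
    (hFc : ∀ j, Fc j =ᵐ[(volume : Measure ℝ).prod volume] fun q => stBar T f q j)
    (hL1 : ∀ᵐ t ∂(volume.restrict (Ioo 0 T)), Integrable (u t) volume)
    (hfL1 : ∀ᵐ t ∂(volume.restrict (Ioo 0 T)), Integrable (f t) volume) {ε : ℝ} (hε : 0 < ε)
    (hε' : ε ≤ 1 / 4)
    (hint : ∀ j, Integrable (fun q : ℝ × UnitAddTorus d => Fc j q *
      (θ q.1 * ((sliceConv (Uc j) (FunctionSpaces.Torus.kernel ε) q.1) ⋆ FunctionSpaces.Torus.kernel ε) q.2))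
      ((volume : Measure ℝ).prod volume)) :
    ∑ j, ∫ q, Fc j q *
        (θ q.1 * ((sliceConv (Uc j) (FunctionSpaces.Torus.kernel ε) q.1) ⋆ FunctionSpaces.Torus.kernel ε) q.2)
        ∂((volume : Measure ℝ).prod volume) =
      ∫ t in Ioo 0 T, θ t * ∫ x, ⟪vecConv (f t) (FunctionSpaces.Torus.kernel ε) x,
        vecConv (u t) (FunctionSpaces.Torus.kernel ε) x⟫_ℝ := by
  set μ : Measure (ℝ × UnitAddTorus d) := (volume : Measure ℝ).prod volume with hμ
  set g : d → ℝ × UnitAddTorus d → ℝ := fun j q => Fc j q *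
    (θ q.1 * ((sliceConv (Uc j) (FunctionSpaces.Torus.kernel ε) q.1) ⋆ FunctionSpaces.Torus.kernel ε) q.2) with hg
  have hintsum : Integrable (fun q => ∑ j, g j q) μ := integrable_finsetSum _ fun j _ => hint j
  rw [show (∑ j, ∫ q, Fc j q *
      (θ q.1 * ((sliceConv (Uc j) (FunctionSpaces.Torus.kernel ε) q.1) ⋆ FunctionSpaces.Torus.kernel ε) q.2) ∂μ) =
      ∑ j, ∫ q, g j q ∂μ from rfl, ← integral_finsetSum _ fun j _ => hint j, integral_prod _ hintsum,
    ← integral_indicator measurableSet_Ioo]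
  have hslint : ∀ᵐ t ∂(volume : Measure ℝ), ∀ j, Integrable (fun x => g j (t, x)) volume :=
    ae_all_iff.2 fun j => (hint j).prod_right_ae
  have hL1' : ∀ᵐ t ∂(volume : Measure ℝ), t ∈ Ioo 0 T → Integrable (u t) volume :=
    (ae_restrict_iff' measurableSet_Ioo).1 hL1
  have hfL1' : ∀ᵐ t ∂(volume : Measure ℝ), t ∈ Ioo 0 T → Integrable (f t) volume :=
    (ae_restrict_iff' measurableSet_Ioo).1 hfL1
  have haeF : ∀ᵐ t ∂(volume : Measure ℝ), ∀ j, (fun y => Fc j (t, y)) =ᵐ[volume] fun y => stBar T f (t, y) j :=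
    ae_slice_eq_of_ae_eq_stBar hFc
  refine integral_congr_ae ?_
  filter_upwards [ae_slice_eq_of_ae_eq_stBar hUc, haeF, hL1', hfL1', hslint] with t hs hsF htL1 htfL1 htint
  by_cases hmem : t ∈ Ioo 0 T
  · rw [indicator_of_mem hmem]
    have hv := htL1 hmem
    have hfv := htfL1 hmem
    have hslice : ∀ j, (fun y => Uc j (t, y)) =ᵐ[volume] fun y => u t y j := fun j => by
      filter_upwards [hs j] with y hy
      rw [hy, stBar_apply_of_mem hmem]
    have hsliceF : ∀ j, (fun y => Fc j (t, y)) =ᵐ[volume] fun y => f t y j := fun j => by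
      filter_upwards [hsF j] with y hy
      rw [hy, stBar_apply_of_mem hmem]
    have hw : ∀ j, sliceConv (Uc j) (FunctionSpaces.Torus.kernel ε) t = (fun y => u t y j) ⋆ FunctionSpaces.Torus.kernel ε := fun j =>
      FunctionSpaces.Torus.convolution_congr_ae_left (ContinuousLinearMap.lsmul ℝ ℝ) (hslice j) _
    have hfi : ∀ j, (fun x => g j (t, x)) =ᵐ[volume] fun x => θ t * (f t x j *
        (((fun y => u t y j) ⋆ FunctionSpaces.Torus.kernel ε) ⋆ FunctionSpaces.Torus.kernel ε) x) := by
      intro j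
      filter_upwards [hsliceF j] with x hxj
      simp only [hg, hw j]
      rw [show Fc j (t, x) = f t x j from hxj]
      ring
    rw [integral_finsetSum _ fun j _ => htint j]
    have h2 : ∀ j, ∫ x, g j (t, x) = θ t * ∫ x, f t x j *
        (((fun y => u t y j) ⋆ FunctionSpaces.Torus.kernel ε) ⋆ FunctionSpaces.Torus.kernel ε) x := fun j => by
      rw [integral_congr_ae (hfi j), integral_const_mul]
    simp_rw [h2, ← Finset.mul_sum]
    rw [sum_integral_mul_sliceC_eq_integral_inner hv hfv hε hε']
  · rw [indicator_of_notMem hmem]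
    have hθ0 : θ t = 0 := image_eq_zero_of_notMem_tsupport fun h => hmem (hθT h)
    have : (fun x => ∑ j, g j (t, x)) = fun _ => 0 := by
      funext x
      simp [hg, hθ0]
    rw [this, integral_zero]

end IdentifyNS


/-! ## The distributional resolved energy balance of forced weak Navier–Stokes solutions -/

section Distributional

variable [DecidableEq d]

/-- **The resolved energy balance in `𝒟'(0,T)` for forced weak Navier–Stokes solutions on
`T^d`** (Drivas–Eyink 2019, §2, proof of Lemma 2: the coarse-grained equations (weak) obtained
"by mollifying the Navier–Stokes equations with (non-solenoidal) test functions
`φᵢ(r,t) = ψ(t) G_ℓ(r - x) eᵢ`", dotted with `ū_ℓ` and integrated over `T^d`; here in the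
legitimate form with the doubly mollified, time-regularised, divergence-free test fields of the
tree's Euler-case `Torus.energyBalance_vecConv_holds`, CCFS 2008 (11)): for a forced weak
solution `u` on `T^d × [0,T)` (`Torus.IsWeakNSSolutionForcedOn T ν f u₀ u`) with `u ∈ L³_{t,x}`,
a jointly measurable force `f ∈ L²_{t,x}`, the mollifier `K = K_ε` and a cut-off
`θ ∈ C_c^∞(0,T)`,
`∫₀ᵀ θ' E(u ⋆ K) = -∫₀ᵀ θ Π_K[u] + ν ∫₀ᵀ θ ‖∇(u ⋆ K)‖₂² - ∫₀ᵀ θ ∫⟪f ⋆ K, u ⋆ K⟫`,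
i.e. `d/dt E(ū) = Π_K[u] - ν‖∇ū‖₂² + ∫⟪f̄, ū⟫` in `𝒟'(0,T)` (`Π_K = Torus.cetFlux = -∫Π_ℓ`).
Compared with the Euler case the weak identity has the two additional *linear* pairings
`ν∫∫⟪u, Δψₙ⟫ → -ν∫θ‖∇ū‖₂²` (the Laplacian falls on the space kernel, `L²` convergence of the
iterated time mollifications, Green's identity on `T^d`) and `∫∫⟪f, ψₙ⟫ → ∫θ∫⟪f̄, ū⟫`
(`f ∈ L²_{t,x}`, evenness of `K`). [cite: DrivasEyink2019, §2, proof of Lemma 2] -/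
theorem IsWeakNSSolutionForcedOn.resolvedEnergyBalance_distrib {T ν : ℝ}
    {f u : ℝ → UnitAddTorus d → EuclideanSpace ℝ d} {u₀ : UnitAddTorus d → EuclideanSpace ℝ d}
    (hu : IsWeakNSSolutionForcedOn T ν f u₀ u)
    (hfm : AEStronglyMeasurable (FunctionSpaces.Torus.stLift f) (volume.restrict (Ioo 0 T ×ˢ univ)))
    (hf2 : ∫⁻ t in Ioo 0 T, ∫⁻ x, ‖f t x‖ₑ ^ 2 < ⊤)
    (hu3 : ∫⁻ t in Ioo 0 T, ∫⁻ x, ‖u t x‖ₑ ^ 3 < ⊤) {ε : ℝ} (hε : 0 < ε) (hε' : ε ≤ 1 / 4)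
    {θ : ℝ → ℝ} (hθ : ContDiff ℝ ∞ θ) (hθc : HasCompactSupport θ) (hθT : tsupport θ ⊆ Ioo 0 T) :
    ∫ t in Ioo 0 T, deriv θ t * FunctionSpaces.Torus.kineticEnergy (vecConv (u t) (FunctionSpaces.Torus.kernel ε)) =
      -(∫ t in Ioo 0 T, θ t * cetFlux (FunctionSpaces.Torus.kernel ε) (u t)) +
        ν * (∫ t in Ioo 0 T, θ t * FunctionSpaces.Torus.gradNormSq (vecConv (u t) (FunctionSpaces.Torus.kernel ε))) -
        ∫ t in Ioo 0 T, θ t * ∫ x, ⟪vecConv (f t) (FunctionSpaces.Torus.kernel ε) x,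
          vecConv (u t) (FunctionSpaces.Torus.kernel ε) x⟫_ℝ := by
  -- degenerate time interval
  rcases le_or_gt T 0 with hT | hT
  · simp [Ioo_eq_empty_of_le hT, Measure.restrict_empty]
  set μ : Measure (ℝ × UnitAddTorus d) := (volume : Measure ℝ).prod volume with hμ
  -- the kernel
  have hKs : FunctionSpaces.Torus.IsSmooth (FunctionSpaces.Torus.kernel (d := d) ε) := FunctionSpaces.Torus.isSmooth_kernel hε hε'
  have hKc : Continuous (FunctionSpaces.Torus.kernel (d := d) ε) := hKs.continuous
  have hKeven : ∀ z : UnitAddTorus d, FunctionSpaces.Torus.kernel ε (-z) = FunctionSpaces.Torus.kernel ε z := FunctionSpaces.Torus.kernel_neg hε hε'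
  -- the support of `θ`
  obtain ⟨a, b, ha, hab, hb, hθab⟩ := FunctionSpaces.exists_Icc_subset_Ioo_of_tsupport_subset hT hθc hθT
  set δ₀ : ℝ := min a (T - b) / 2 with hδ₀
  have hδ₀pos : 0 < δ₀ := by
    have : 0 < min a (T - b) := lt_min ha (by linarith)
    positivity
  have hδ₀a : δ₀ < a := by
    have := min_le_left a (T - b); rw [hδ₀]; linarith [lt_min ha (show 0 < T - b by linarith)]
  have hδ₀b : b + δ₀ < T := by
    have := min_le_right a (T - b); rw [hδ₀]; linarith [lt_min ha (show 0 < T - b by linarith)]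
  obtain ⟨φ, hφlt, hφ0⟩ := exists_contDiffBump_seq_lt hδ₀pos
  -- measurability and integrability of the (extended) velocity and force
  have hm : AEStronglyMeasurable (uncurry u) ((volume.restrict (Ioo 0 T)).prod volume) :=
    aestronglyMeasurable_uncurry_restrict_prod_of_stLift hu.1
  have hfm' : AEStronglyMeasurable (uncurry f) ((volume.restrict (Ioo 0 T)).prod volume) :=
    aestronglyMeasurable_uncurry_restrict_prod_of_stLift hfm
  have hbar1 : Integrable (stBar T u) μ := integrable_stBar hm hu.2.1
  have hbar2 : MemLp (stBar T u) 2 μ := by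
    have := memLp_stBar hm two_ne_zero hu.2.1
    simpa using this
  have hbar3 : MemLp (stBar T u) 3 μ := by
    have := memLp_stBar hm (by norm_num : (3 : ℕ) ≠ 0) hu3
    simpa using this
  have hfbar1 : Integrable (stBar T f) μ := integrable_stBar hfm' hf2
  have hfbar2 : MemLp (stBar T f) 2 μ := by
    have := memLp_stBar hfm' two_ne_zero hf2
    simpa using this
  -- strongly measurable representatives of the components
  have hsm : ∀ j, AEStronglyMeasurable (fun q => stBar T u q j) μ := fun j => (hbar2.eval_piLp j).1
  set Uc : d → ℝ × UnitAddTorus d → ℝ := fun j => (hsm j).mk _ with hUcdef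
  have hUm : ∀ j, StronglyMeasurable (Uc j) := fun j => (hsm j).stronglyMeasurable_mk
  have hUc : ∀ j, Uc j =ᵐ[μ] fun q => stBar T u q j := fun j => (hsm j).ae_eq_mk.symm
  have hU1 : ∀ j, Integrable (Uc j) μ := fun j =>
    ((EuclideanSpace.proj (𝕜 := ℝ) j).integrable_comp hbar1).congr (hsm j).ae_eq_mk
  have hU2 : ∀ j, MemLp (Uc j) 2 μ := fun j => (hbar2.eval_piLp j).ae_eq (hsm j).ae_eq_mk
  have hU3 : ∀ j, MemLp (Uc j) 3 μ := fun j => (hbar3.eval_piLp j).ae_eq (hsm j).ae_eq_mk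
  have hU32 : ∀ j i, MemLp (fun q => Uc j q * Uc i q) (3 / 2) μ := fun j i => by
    haveI := FunctionSpaces.holderTriple_three_three
    exact (hU3 i).mul (hU3 j)
  have hfsm : ∀ j, AEStronglyMeasurable (fun q => stBar T f q j) μ := fun j => (hfbar2.eval_piLp j).1
  set Fc : d → ℝ × UnitAddTorus d → ℝ := fun j => (hfsm j).mk _ with hFcdef
  have hFc : ∀ j, Fc j =ᵐ[μ] fun q => stBar T f q j := fun j => (hfsm j).ae_eq_mk.symm
  have hF2 : ∀ j, MemLp (Fc j) 2 μ := fun j => (hfbar2.eval_piLp j).ae_eq (hfsm j).ae_eq_mk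
  -- weak divergence-freeness of the representatives' slices
  have hL3 : ∀ᵐ t ∂(volume.restrict (Ioo 0 T)), MemLp (u t) 3 volume :=
    ae_memLp_three_of_lintegral hm hu3
  have hL1 : ∀ᵐ t ∂(volume.restrict (Ioo 0 T)), Integrable (u t) volume :=
    hL3.mono fun t ht => ht.integrable (by norm_num)
  have hfL1 : ∀ᵐ t ∂(volume.restrict (Ioo 0 T)), Integrable (f t) volume := by
    have hsec : ∀ᵐ t ∂(volume.restrict (Ioo 0 T)), AEStronglyMeasurable (f t) volume := hfm'.prodMk_left
    have hmeas : AEMeasurable (fun t => ∫⁻ x, ‖f t x‖ₑ ^ 2) (volume.restrict (Ioo 0 T)) :=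
      ((hfm'.enorm.pow_const 2)).lintegral_prod_right'
    have hfin : ∀ᵐ t ∂(volume.restrict (Ioo 0 T)), ∫⁻ x, ‖f t x‖ₑ ^ 2 < ⊤ := ae_lt_top' hmeas hf2.ne
    filter_upwards [hsec, hfin] with t ht htfin
    have h2 : MemLp (f t) 2 volume := by
      refine ⟨ht, ?_⟩
      rw [eLpNorm_eq_lintegral_rpow_enorm_toReal (by norm_num) (by norm_num)]
      refine ENNReal.rpow_lt_top_of_nonneg (by norm_num) (ne_of_lt ?_)
      have h2r : ((2 : ℝ≥0∞)).toReal = ((2 : ℕ) : ℝ) := by norm_num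
      simp_rw [h2r, ENNReal.rpow_natCast]
      exact htfin
    exact h2.integrable one_le_two
  have hdivae : ∀ᵐ r ∂(volume : Measure ℝ), ∀ z, ∑ j, ((fun y => Uc j (r, y)) ⋆ FunctionSpaces.Torus.partialDeriv j (FunctionSpaces.Torus.kernel ε)) z = 0 := by
    have hdiv' : ∀ᵐ t ∂(volume : Measure ℝ), t ∈ Ioo 0 T → FunctionSpaces.Torus.IsWeaklyDivFree (u t) :=
      (ae_restrict_iff' measurableSet_Ioo).1 hu.2.2.1
    have hL1' : ∀ᵐ t ∂(volume : Measure ℝ), t ∈ Ioo 0 T → Integrable (u t) volume :=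
      (ae_restrict_iff' measurableSet_Ioo).1 hL1
    filter_upwards [ae_slice_eq_of_ae_eq_stBar hUc, hdiv', hL1'] with r hs hrdiv hrL1
    intro z
    by_cases hr : r ∈ Ioo 0 T
    · have hslice : ∀ j, (fun y => Uc j (r, y)) =ᵐ[volume] fun y => u r y j := fun j => by
        filter_upwards [hs j] with y hy
        rw [hy, stBar_apply_of_mem hr]
      have : ∀ j, ((fun y => Uc j (r, y)) ⋆ FunctionSpaces.Torus.partialDeriv j (FunctionSpaces.Torus.kernel ε)) z =
          ((fun y => u r y j) ⋆ FunctionSpaces.Torus.partialDeriv j (FunctionSpaces.Torus.kernel ε)) z := fun j => by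
        rw [FunctionSpaces.Torus.convolution_congr_ae_left (ContinuousLinearMap.lsmul ℝ ℝ) (hslice j)]
      simp_rw [this]
      exact sum_convolution_partialDeriv_eq_zero (hrL1 hr) (hrdiv hr) hKs z
    · have hslice : ∀ j, (fun y => Uc j (r, y)) =ᵐ[volume] fun _ => (0 : ℝ) := fun j => by
        filter_upwards [hs j] with y hy
        rw [hy, stBar_apply_of_not_mem hr]
        rfl
      have : ∀ j, ((fun y => Uc j (r, y)) ⋆ FunctionSpaces.Torus.partialDeriv j (FunctionSpaces.Torus.kernel ε)) z = 0 := fun j => by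
        rw [FunctionSpaces.Torus.convolution_congr_ae_left (ContinuousLinearMap.lsmul ℝ ℝ) (hslice j)]
        have : (fun _ : UnitAddTorus d => (0 : ℝ)) = 0 := rfl
        rw [this, zero_convolution]
        rfl
      simp [this]
  -- the time kernels
  set ρ : ℕ → ℝ → ℝ := fun n => (φ n).normed volume with hρdef
  have hρs : ∀ n, ContDiff ℝ ∞ (ρ n) := fun n => (φ n).contDiff_normed
  have hρc : ∀ n, HasCompactSupport (ρ n) := fun n => (φ n).hasCompactSupport_normed
  have hρeven : ∀ n r, ρ n (-r) = ρ n r := fun n r => (φ n).normed_neg r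
  have hρsupp : ∀ n r, ρ n r ≠ 0 → |r| < δ₀ := fun n r h =>
    (abs_lt_of_normed_ne_zero (φ n) h).trans (hφlt n)
  have hρ1 : ∀ n, ContDiff ℝ 1 (ρ n) := fun n => (hρs n).of_le (by norm_cast)
  have hK1 : FunctionSpaces.Torus.IsContDiff 1 (FunctionSpaces.Torus.kernel (d := d) ε) := hKs.isContDiff (by simp)
  -- the test fields and their admissibility
  set ψc : ℕ → d → ℝ → UnitAddTorus d → ℝ := fun n j => cetTest (ρ n) (FunctionSpaces.Torus.kernel ε) θ (Uc j) with hψcdef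
  have hG : ∀ n j, Integrable (fun p : ℝ × UnitAddTorus d => θ p.1 * FunctionSpaces.Torus.stConv (ρ n) (FunctionSpaces.Torus.kernel ε) (Uc j) p.1 p.2) μ :=
    fun n j => integrable_cutoff_stConv (hU1 j) (hρs n) (hρc n) hKs hθ hθc
  have hψs : ∀ n j, ContDiff ℝ ∞ (FunctionSpaces.Torus.stLift (ψc n j)) := fun n j =>
    contDiff_stLift_cetTest (hU1 j) (hρs n) (hρc n) hKs hθ hθc
  have hψzero : ∀ n t, (t ≤ a - δ₀ ∨ b + δ₀ ≤ t) → vecField (ψc n) t = 0 := by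
    intro n t ht
    funext x
    ext j
    simp only [vecField_apply, hψcdef]
    rw [cetTest_eq_zero_of_dist hθab (hρsupp n) ht x]
    rfl
  have htest : ∀ n, FunctionSpaces.Torus.IsSpaceTimeTestIoo T (vecField (ψc n)) := fun n =>
    ⟨⟨by rw [stLift_vecField]; exact contDiff_piLp' (p := 2) fun j => hψs n j,
      b + δ₀, hδ₀b, fun t ht => hψzero n t (Or.inr ht)⟩,
      a - δ₀, by linarith, fun t ht => hψzero n t (Or.inl ht)⟩
  have hdivt : ∀ n, FunctionSpaces.Torus.IsDivFreeTest (vecField (ψc n)) := fun n t =>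
    isDivFree_cetTest hU1 (hρs n) (hρc n) hKs hθ hθc hdivae t
  have hweak : ∀ n, ∫ t in Ioo 0 T, ∫ x, (⟪u t x, FunctionSpaces.Torus.timeDeriv (vecField (ψc n)) t x⟫_ℝ +
      ⟪u t x, FunctionSpaces.Torus.convect (u t) (vecField (ψc n) t) x⟫_ℝ +
        ν * ⟪u t x, FunctionSpaces.Torus.laplacian (vecField (ψc n) t) x⟫_ℝ + ⟪f t x, vecField (ψc n) t x⟫_ℝ) = 0 := by
    intro n
    have h := hu.2.2.2 _ (htest n).1 (hdivt n)
    rw [(htest n).apply_zero] at h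
    simpa using h
  -- derivative formulas for the components, continuity and bounds
  have hdt : ∀ n j t x, FunctionSpaces.Torus.timeDeriv (ψc n j) t x =
      FunctionSpaces.Torus.stConv (deriv (ρ n)) (FunctionSpaces.Torus.kernel ε) (fun p => θ p.1 * FunctionSpaces.Torus.stConv (ρ n) (FunctionSpaces.Torus.kernel ε) (Uc j) p.1 p.2) t x :=
    fun n j t x => FunctionSpaces.Torus.timeDeriv_stConv (hG n j) (hρ1 n) (hρc n) hK1 t x
  have hdx : ∀ n j i t x, FunctionSpaces.Torus.partialDeriv i (ψc n j t) x =
      FunctionSpaces.Torus.stConv (ρ n) (FunctionSpaces.Torus.partialDeriv i (FunctionSpaces.Torus.kernel ε)) (fun p => θ p.1 * FunctionSpaces.Torus.stConv (ρ n) (FunctionSpaces.Torus.kernel ε) (Uc j) p.1 p.2) t x :=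
    fun n j i t x => FunctionSpaces.Torus.partialDeriv_stConv (hG n j) (hρ1 n) (hρc n) hK1 i t x
  -- the Laplacian as a sum of `stConv`'s with the kernels `∂ᵢ∂ᵢK`
  have hdL : ∀ n j t x, FunctionSpaces.Torus.laplacian (ψc n j t) x =
      ∑ i, FunctionSpaces.Torus.stConv (ρ n) (FunctionSpaces.Torus.partialDeriv i (FunctionSpaces.Torus.partialDeriv i (FunctionSpaces.Torus.kernel ε)))
        (fun p => θ p.1 * FunctionSpaces.Torus.stConv (ρ n) (FunctionSpaces.Torus.kernel ε) (Uc j) p.1 p.2) t x := by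
    intro n j t x
    have hslice : FunctionSpaces.Torus.IsSmooth (ψc n j t) := isSmooth_slice_of_contDiff_stLift (hψs n j) t
    rw [FunctionSpaces.Torus.laplacian_eq_sum_partialDeriv_partialDeriv hslice]
    refine Finset.sum_congr rfl fun i _ => ?_
    have h1 : FunctionSpaces.Torus.partialDeriv i (ψc n j t) =
        FunctionSpaces.Torus.stConv (ρ n) (FunctionSpaces.Torus.partialDeriv i (FunctionSpaces.Torus.kernel ε))
          (fun p => θ p.1 * FunctionSpaces.Torus.stConv (ρ n) (FunctionSpaces.Torus.kernel ε) (Uc j) p.1 p.2) t := funext (hdx n j i t)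
    rw [h1, FunctionSpaces.Torus.partialDeriv_stConv (hG n j) (hρ1 n) (hρc n) ((hKs.partialDeriv i).isContDiff (by simp)) i t x]
  have hcont_st : ∀ n j {k' : UnitAddTorus d → ℝ}, FunctionSpaces.Torus.IsSmooth k' → ∀ (η : ℝ → ℝ), ContDiff ℝ ∞ η → HasCompactSupport η →
      Continuous (uncurry (FunctionSpaces.Torus.stConv η k' (fun p => θ p.1 * FunctionSpaces.Torus.stConv (ρ n) (FunctionSpaces.Torus.kernel ε) (Uc j) p.1 p.2))) :=
    fun n j k' hk' η hη hηc => FunctionSpaces.Torus.continuous_uncurry_of_continuous_stLift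
      (FunctionSpaces.Torus.contDiff_top_stLift_stConv (hG n j) hη hηc hk').continuous
  have hdtc : ∀ n j, Continuous (uncurry (FunctionSpaces.Torus.timeDeriv (ψc n j))) := fun n j => by
    have : uncurry (FunctionSpaces.Torus.timeDeriv (ψc n j)) = uncurry (FunctionSpaces.Torus.stConv (deriv (ρ n)) (FunctionSpaces.Torus.kernel ε)
        (fun p => θ p.1 * FunctionSpaces.Torus.stConv (ρ n) (FunctionSpaces.Torus.kernel ε) (Uc j) p.1 p.2)) := by
      funext q; exact hdt n j q.1 q.2
    rw [this]
    exact hcont_st n j hKs _ (hρs n).deriv' (hρc n).deriv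
  have hdxc : ∀ n j i, Continuous (uncurry fun t x => FunctionSpaces.Torus.partialDeriv i (ψc n j t) x) := fun n j i => by
    have : (uncurry fun t x => FunctionSpaces.Torus.partialDeriv i (ψc n j t) x) = uncurry (FunctionSpaces.Torus.stConv (ρ n) (FunctionSpaces.Torus.partialDeriv i (FunctionSpaces.Torus.kernel ε))
        (fun p => θ p.1 * FunctionSpaces.Torus.stConv (ρ n) (FunctionSpaces.Torus.kernel ε) (Uc j) p.1 p.2)) := by
      funext q; exact hdx n j i q.1 q.2
    rw [this]
    exact hcont_st n j (hKs.partialDeriv i) _ (hρs n) (hρc n)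
  have hdLc : ∀ n j, Continuous (uncurry fun t x => FunctionSpaces.Torus.laplacian (ψc n j t) x) := fun n j => by
    have : (uncurry fun t x => FunctionSpaces.Torus.laplacian (ψc n j t) x) = fun q => ∑ i, uncurry (FunctionSpaces.Torus.stConv (ρ n)
        (FunctionSpaces.Torus.partialDeriv i (FunctionSpaces.Torus.partialDeriv i (FunctionSpaces.Torus.kernel ε)))
        (fun p => θ p.1 * FunctionSpaces.Torus.stConv (ρ n) (FunctionSpaces.Torus.kernel ε) (Uc j) p.1 p.2)) q := by
      funext q; simp only [uncurry]; exact hdL n j q.1 q.2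
    rw [this]
    exact continuous_finsetSum _ fun i _ => hcont_st n j ((hKs.partialDeriv i).partialDeriv i) _ (hρs n) (hρc n)
  have hψcont : ∀ n j, Continuous (uncurry (ψc n j)) := fun n j =>
    FunctionSpaces.Torus.continuous_uncurry_of_continuous_stLift (hψs n j).continuous
  have hdtb : ∀ n j, ∃ C, ∀ t x, |FunctionSpaces.Torus.timeDeriv (ψc n j) t x| ≤ C := fun n j => by
    obtain ⟨C, hC⟩ := exists_abs_stConv_le (hG n j) ((hρs n).continuous_deriv (by simp)) (hρc n).deriv hKc
    exact ⟨C, fun t x => by rw [hdt]; exact hC t x⟩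
  have hdxb : ∀ n j i, ∃ C, ∀ t x, |FunctionSpaces.Torus.partialDeriv i (ψc n j t) x| ≤ C := fun n j i => by
    obtain ⟨C, hC⟩ := exists_abs_stConv_le (hG n j) (hρs n).continuous (hρc n)
      (hKs.partialDeriv i).continuous
    exact ⟨C, fun t x => by rw [hdx]; exact hC t x⟩
  have hdLb : ∀ n j, ∃ C, ∀ t x, |FunctionSpaces.Torus.laplacian (ψc n j t) x| ≤ C := fun n j => by
    have hC : ∀ i, ∃ C, ∀ t x, |FunctionSpaces.Torus.stConv (ρ n)
        (FunctionSpaces.Torus.partialDeriv i (FunctionSpaces.Torus.partialDeriv i (FunctionSpaces.Torus.kernel ε)))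
        (fun p => θ p.1 * FunctionSpaces.Torus.stConv (ρ n) (FunctionSpaces.Torus.kernel ε) (Uc j) p.1 p.2) t x| ≤ C := fun i =>
      exists_abs_stConv_le (hG n j) (hρs n).continuous (hρc n) ((hKs.partialDeriv i).partialDeriv i).continuous
    choose C hC using hC
    refine ⟨∑ i, C i, fun t x => ?_⟩
    rw [hdL]
    exact (Finset.abs_sum_le_sum_abs _ _).trans (Finset.sum_le_sum fun i _ => hC i t x)
  have hψb : ∀ n j, ∃ C, ∀ t x, |ψc n j t x| ≤ C := fun n j =>
    exists_abs_stConv_le (hG n j) (hρs n).continuous (hρc n) hKc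
  -- (Eₙ): the rewritten weak identity
  have hEn : ∀ n, ∑ j, ∫ q, Uc j q * FunctionSpaces.Torus.timeDeriv (ψc n j) q.1 q.2 ∂μ +
      ∑ j, ∑ i, ∫ q, Uc j q * Uc i q * FunctionSpaces.Torus.partialDeriv i (ψc n j q.1) q.2 ∂μ +
      ν * ∑ j, ∫ q, Uc j q * FunctionSpaces.Torus.laplacian (ψc n j q.1) q.2 ∂μ +
      ∑ j, ∫ q, Fc j q * ψc n j q.1 q.2 ∂μ = 0 := fun n =>
    weakFormNS_rewrite (hweak n) (hψs n) (hdtc n) (hdxc n) (hdLc n) (hdtb n) (hdxb n) (hdLb n) (hψb n)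
      hbar1 hbar2 hfbar1 hUc hFc
  -- bounds for `θ`, `θ'`
  obtain ⟨Cθ, hCθ⟩ := FunctionSpaces.exists_forall_abs_le_of_hasCompactSupport hθ.continuous hθc
  have hθ'c : Continuous (deriv θ) := hθ.continuous_deriv (by simp)
  obtain ⟨Cθ', hCθ'⟩ := FunctionSpaces.exists_forall_abs_le_of_hasCompactSupport hθ'c hθc.deriv
  -- the space-mollified slices `wⱼ` and the second-level slices
  set w : d → ℝ → UnitAddTorus d → ℝ := fun j => sliceConv (Uc j) (FunctionSpaces.Torus.kernel ε) with hwdef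
  have hw_sm : ∀ j, StronglyMeasurable (uncurry (w j)) := fun j =>
    stronglyMeasurable_uncurry_sliceConv (hUm j) hKc
  have hKint : ∫⁻ y, ‖FunctionSpaces.Torus.kernel (d := d) ε y‖ₑ < ⊤ := hKc.integrable_unitAddTorus.2
  have hw2 : ∀ j, eLpNorm (uncurry (w j)) 2 μ < ⊤ := fun j =>
    (eLpNorm_uncurry_sliceConv_le (hUm j) hKc one_le_two ENNReal.ofNat_ne_top).trans_lt
      (ENNReal.mul_lt_top hKint (hU2 j).2)
  have hw3 : ∀ j, eLpNorm (uncurry (w j)) 3 μ < ⊤ := fun j =>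
    (eLpNorm_uncurry_sliceConv_le (hUm j) hKc (by norm_num) (by norm_num)).trans_lt
      (ENNReal.mul_lt_top hKint (hU3 j).2)
  -- generic second-level slice through a continuous kernel `k'`
  have hslice2 : ∀ j {k' : UnitAddTorus d → ℝ} (hk' : Continuous k') {p : ℝ≥0∞} (hp : 1 ≤ p) (hp' : p ≠ ⊤),
      eLpNorm (uncurry (w j)) p μ < ⊤ →
      StronglyMeasurable (uncurry fun r x => ((w j r) ⋆ k') x) ∧ eLpNorm (uncurry fun r x => ((w j r) ⋆ k') x) p μ < ⊤ := by
    intro j k' hk' p hp hp' hwp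
    refine ⟨stronglyMeasurable_uncurry_sliceConv (U := uncurry (w j)) (hw_sm j) hk', ?_⟩
    exact (eLpNorm_uncurry_sliceConv_le (U := uncurry (w j)) (hw_sm j) hk' hp hp').trans_lt
      (ENNReal.mul_lt_top (hk'.integrable_unitAddTorus.2) hwp)
  set B : d → d → ℝ → UnitAddTorus d → ℝ := fun j i r x => ((w j r) ⋆ FunctionSpaces.Torus.partialDeriv i (FunctionSpaces.Torus.kernel ε)) x
    with hBdef
  have hB_sm : ∀ j i, StronglyMeasurable (uncurry (B j i)) := fun j i =>
    (hslice2 j (hKs.partialDeriv i).continuous (by norm_num) (by norm_num) (hw3 j)).1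
  have hB3 : ∀ j i, eLpNorm (uncurry (B j i)) 3 μ < ⊤ := fun j i =>
    (hslice2 j (hKs.partialDeriv i).continuous (by norm_num) (by norm_num) (hw3 j)).2
  set Lk : d → d → ℝ → UnitAddTorus d → ℝ := fun j i r x => ((w j r) ⋆
    FunctionSpaces.Torus.partialDeriv i (FunctionSpaces.Torus.partialDeriv i (FunctionSpaces.Torus.kernel ε))) x with hLkdef
  have hLk_sm : ∀ j i, StronglyMeasurable (uncurry (Lk j i)) := fun j i =>
    (hslice2 j ((hKs.partialDeriv i).partialDeriv i).continuous one_le_two ENNReal.ofNat_ne_top (hw2 j)).1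
  have hLk2 : ∀ j i, eLpNorm (uncurry (Lk j i)) 2 μ < ⊤ := fun j i =>
    (hslice2 j ((hKs.partialDeriv i).partialDeriv i).continuous one_le_two ENNReal.ofNat_ne_top (hw2 j)).2
  set Ck : d → ℝ → UnitAddTorus d → ℝ := fun j r x => ((w j r) ⋆ FunctionSpaces.Torus.kernel ε) x with hCkdef
  have hCk_sm : ∀ j, StronglyMeasurable (uncurry (Ck j)) := fun j =>
    (hslice2 j hKc one_le_two ENNReal.ofNat_ne_top (hw2 j)).1
  have hCk2 : ∀ j, eLpNorm (uncurry (Ck j)) 2 μ < ⊤ := fun j =>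
    (hslice2 j hKc one_le_two ENNReal.ofNat_ne_top (hw2 j)).2
  ---------------------------------------------------------------- Term 1
  set A : ℕ → d → ℝ := fun n j => ∫ q, deriv θ q.1 *
    (((ρ n) ⋆ fun r => w j r q.2) q.1) ^ 2 ∂μ with hAdef
  set Ainf : d → ℝ := fun j => ∫ q, deriv θ q.1 * (w j q.1 q.2) ^ 2 ∂μ with hAinfdef
  have hθ'i : Integrable (fun p : ℝ × UnitAddTorus d => deriv θ p.1) μ := by
    have h1 : Integrable (deriv θ) (volume : Measure ℝ) := hθ'c.integrable_of_hasCompactSupport hθc.deriv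
    have := h1.mul_prod (f := deriv θ) (g := fun _ : UnitAddTorus d => (1 : ℝ))
      (integrable_const (μ := (volume : Measure (UnitAddTorus d))) (1 : ℝ))
    simpa using this
  have hT1form : ∀ n j, ∫ q, Uc j q * FunctionSpaces.Torus.timeDeriv (ψc n j) q.1 q.2 ∂μ = 2⁻¹ * A n j := by
    intro n j
    rw [show ψc n j = cetTest (ρ n) (FunctionSpaces.Torus.kernel ε) θ (Uc j) from rfl,
      integral_mul_timeDeriv_cetTest (hU1 j) (hρs n) (hρc n) (hρeven n) hKs hKeven hθ hθc]
    congr 1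
    obtain ⟨M, hM⟩ := exists_abs_stConv_le (hU1 j) (hρs n).continuous (hρc n) hKc
    have hWc : Continuous (uncurry (FunctionSpaces.Torus.stConv (ρ n) (FunctionSpaces.Torus.kernel ε) (Uc j))) :=
      FunctionSpaces.Torus.continuous_uncurry_of_continuous_stLift (FunctionSpaces.Torus.contDiff_top_stLift_stConv (hU1 j) (hρs n) (hρc n) hKs).continuous
    have hint : Integrable (fun q : ℝ × UnitAddTorus d => deriv θ q.1 *
        (FunctionSpaces.Torus.stConv (ρ n) (FunctionSpaces.Torus.kernel ε) (Uc j) q.1 q.2) ^ 2) μ :=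
      hθ'i.mul_bdd (c := M ^ 2) ((hWc.pow 2).aestronglyMeasurable) (Eventually.of_forall fun q => by
        rw [Real.norm_eq_abs, abs_pow]
        exact pow_le_pow_left₀ (abs_nonneg _) (hM _ _) 2)
    have heq : A n j = ∫ q, deriv θ q.1 * (FunctionSpaces.Torus.stConv (ρ n) (FunctionSpaces.Torus.kernel ε) (Uc j) q.1 q.2) ^ 2 ∂μ := by
      refine integral_congr_ae (Eventually.of_forall fun q => ?_)
      exact congrArg (fun v : ℝ => deriv θ q.1 * v ^ 2)
        (FunctionSpaces.Torus.stConv_eq_timeConv (hU1 j) (hρs n).continuous (hρc n) hKc q.1 q.2).symm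
    rw [heq, integral_prod _ hint]
    refine integral_congr_ae (Eventually.of_forall fun s => ?_)
    exact (integral_const_mul _ _).symm
  have hT1lim : Tendsto (fun n => ∑ j, 2⁻¹ * A n j) atTop (𝓝 (∑ j, 2⁻¹ * Ainf j)) := by
    refine tendsto_finsetSum _ fun j _ => ?_
    exact (tendsto_integral_cutoff_sq_timeConv (μ := (volume : Measure (UnitAddTorus d))) hφ0
      (hw_sm j) (hw2 j) hθ'c hCθ').const_mul 2⁻¹
  have hT1id : ∑ j, 2⁻¹ * Ainf j = ∫ s in Ioo 0 T, deriv θ s * FunctionSpaces.Torus.kineticEnergy (vecConv (u s) (FunctionSpaces.Torus.kernel ε)) := by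
    rw [← integral_deriv_mul_sum_sq_sliceConv_eq hθT hUc hL1 hKc]
    have hwint : ∀ j, Integrable (fun q : ℝ × UnitAddTorus d => deriv θ q.1 * (w j q.1 q.2) ^ 2) μ := by
      intro j
      have hw' : MemLp (uncurry (w j)) 2 μ := ⟨(hw_sm j).aestronglyMeasurable, hw2 j⟩
      have h2 : Integrable (fun q => (uncurry (w j) q) ^ 2) μ := by
        have := hw'.integrable_mul hw'
        refine this.congr (Eventually.of_forall fun q => ?_)
        simp only [Pi.mul_apply, sq]
      exact h2.bdd_mul ((hθ'c.measurable.comp measurable_fst).aestronglyMeasurable)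
        (Eventually.of_forall fun q => by rw [Real.norm_eq_abs]; exact hCθ' _)
    have hAinf : ∀ j, Ainf j = ∫ s, deriv θ s * ∫ z, (w j s z) ^ 2 := fun j => by
      simp only [hAinfdef]
      rw [integral_prod _ (hwint j)]
      refine integral_congr_ae (Eventually.of_forall fun s => ?_)
      show ∫ y, deriv θ s * (w j s y) ^ 2 = deriv θ s * ∫ z, (w j s z) ^ 2
      exact integral_const_mul _ _
    have hslint : ∀ j, Integrable (fun s => deriv θ s * ∫ z, (w j s z) ^ 2) (volume : Measure ℝ) := by
      intro j
      have := (hwint j).integral_prod_left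
      refine this.congr (Eventually.of_forall fun s => ?_)
      show ∫ y, deriv θ s * (w j s y) ^ 2 = deriv θ s * ∫ z, (w j s z) ^ 2
      exact integral_const_mul _ _
    simp_rw [hAinf]
    rw [← Finset.mul_sum, ← integral_finsetSum _ fun j _ => hslint j, ← integral_const_mul]
    refine integral_congr_ae (Eventually.of_forall fun s => ?_)
    show 2⁻¹ * ∑ i, deriv θ s * ∫ z, (w i s z) ^ 2 =
      deriv θ s * (2⁻¹ * ∑ j, ∫ z, (sliceConv (Uc j) (FunctionSpaces.Torus.kernel ε) s z) ^ 2)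
    simp only [Finset.mul_sum, hwdef]
    refine Finset.sum_congr rfl fun j _ => ?_
    ring
  ---------------------------------------------------------------- Term 2
  set g : ℕ → d → d → ℝ × UnitAddTorus d → ℝ := fun n j i q => FunctionSpaces.Torus.partialDeriv i (ψc n j q.1) q.2 with hgdef
  set ginf : d → d → ℝ × UnitAddTorus d → ℝ := fun j i q => θ q.1 * B j i q.1 q.2 with hginfdef
  have hgform : ∀ n j i, g n j i = fun q => ((ρ n) ⋆ fun s => θ s * ((ρ n) ⋆ fun r => B j i r q.2) s) q.1 := by
    intro n j i
    funext q
    simp only [hgdef]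
    rw [show ψc n j = cetTest (ρ n) (FunctionSpaces.Torus.kernel ε) θ (Uc j) from rfl,
      partialDeriv_cetTest_eq (hUm j) (hU1 j) (hρs n) (hρc n) hKs hθ hθc i q.1 q.2]
  have hcut : ∀ {G : ℝ → UnitAddTorus d → ℝ} (hGm : StronglyMeasurable (uncurry G)) {p : ℝ≥0∞} (hGp : eLpNorm (uncurry G) p μ < ⊤),
      MemLp (fun q : ℝ × UnitAddTorus d => θ q.1 * G q.1 q.2) p μ := by
    intro G hGm p hGp
    refine ⟨((hθ.continuous.measurable.comp measurable_fst).stronglyMeasurable.mul hGm).aestronglyMeasurable, ?_⟩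
    refine lt_of_le_of_lt (eLpNorm_le_mul_eLpNorm_of_ae_le_mul (g := uncurry G) (c := Cθ)
      (Eventually.of_forall fun q => ?_) p) (ENNReal.mul_lt_top ENNReal.ofReal_lt_top hGp)
    simp only [uncurry, norm_mul, Real.norm_eq_abs]
    exact mul_le_mul_of_nonneg_right (hCθ _) (abs_nonneg _)
  have hginf : ∀ j i, MemLp (ginf j i) 3 μ := fun j i => hcut (hB_sm j i) (hB3 j i)
  have hconv : ∀ j i, Tendsto (fun n => eLpNorm (fun q => g n j i q - ginf j i q) 3 μ) atTop (𝓝 0) := by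
    intro j i
    simp_rw [hgform]
    exact tendsto_eLpNorm_iteratedTimeConv_sub (μ := (volume : Measure (UnitAddTorus d))) hφ0 (hB_sm j i)
      (by norm_num) (by norm_num) (hB3 j i) hθ.continuous hCθ
  have hT2lim : Tendsto (fun n => ∑ j, ∑ i, ∫ q, Uc j q * Uc i q * g n j i q ∂μ) atTop
      (𝓝 (∑ j, ∑ i, ∫ q, Uc j q * Uc i q * ginf j i q ∂μ)) := by
    refine tendsto_finsetSum _ fun j _ => tendsto_finsetSum _ fun i _ => ?_
    exact tendsto_integral_mul_of_tendsto_eLpNorm_three (f := fun q => Uc j q * Uc i q) (hU32 j i)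
      (fun n => (hdxc n j i).aestronglyMeasurable) (hginf j i) (hconv j i)
  have hT2id : ∑ j, ∑ i, ∫ q, Uc j q * Uc i q * ginf j i q ∂μ =
      ∫ t in Ioo 0 T, θ t * cetFlux (FunctionSpaces.Torus.kernel ε) (u t) := by
    haveI := FunctionSpaces.holderTriple_threeHalves_three
    have hint : ∀ j i, Integrable (fun q => Uc j q * Uc i q * ginf j i q) μ := fun j i => by
      have := (hU32 j i).integrable_mul (hginf j i)
      exact this
    exact integral_sum_mul_cutoff_sliceB_eq hθT hUc hL3 hε hε' hint
  ---------------------------------------------------------------- Term 3 (viscous)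
  set gL : ℕ → d → d → ℝ × UnitAddTorus d → ℝ := fun n j i q => FunctionSpaces.Torus.stConv (ρ n)
    (FunctionSpaces.Torus.partialDeriv i (FunctionSpaces.Torus.partialDeriv i (FunctionSpaces.Torus.kernel ε)))
    (fun p => θ p.1 * FunctionSpaces.Torus.stConv (ρ n) (FunctionSpaces.Torus.kernel ε) (Uc j) p.1 p.2) q.1 q.2 with hgLdef
  set gLinf : d → d → ℝ × UnitAddTorus d → ℝ := fun j i q => θ q.1 * Lk j i q.1 q.2 with hgLinfdef
  have hgLform : ∀ n j i, gL n j i = fun q => ((ρ n) ⋆ fun s => θ s * ((ρ n) ⋆ fun r => Lk j i r q.2) s) q.1 := by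
    intro n j i
    funext q
    simp only [hgLdef]
    exact stConv_cutoff_eq_iteratedTimeConv (hUm j) (hU1 j) (hρs n) (hρc n) hKs hθ hθc
      (((hKs.partialDeriv i).partialDeriv i).continuous) q.1 q.2
  have hgLinf : ∀ j i, MemLp (gLinf j i) 2 μ := fun j i => hcut (hLk_sm j i) (hLk2 j i)
  have hgLc : ∀ n j i, Continuous (gL n j i) := fun n j i =>
    hcont_st n j ((hKs.partialDeriv i).partialDeriv i) _ (hρs n) (hρc n)
  have hconvL : ∀ j i, Tendsto (fun n => eLpNorm (fun q => gL n j i q - gLinf j i q) 2 μ) atTop (𝓝 0) := by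
    intro j i
    simp_rw [hgLform]
    exact tendsto_eLpNorm_iteratedTimeConv_sub (μ := (volume : Measure (UnitAddTorus d))) hφ0 (hLk_sm j i)
      one_le_two ENNReal.ofNat_ne_top (hLk2 j i) hθ.continuous hCθ
  have hT3form : ∀ n j, ∫ q, Uc j q * FunctionSpaces.Torus.laplacian (ψc n j q.1) q.2 ∂μ = ∑ i, ∫ q, Uc j q * gL n j i q ∂μ := by
    intro n j
    have hint : ∀ i, Integrable (fun q => Uc j q * gL n j i q) μ := fun i => by
      obtain ⟨C, hC⟩ := exists_abs_stConv_le (hG n j) (hρs n).continuous (hρc n) ((hKs.partialDeriv i).partialDeriv i).continuous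
      exact (hU1 j).mul_bdd (hgLc n j i).aestronglyMeasurable (Eventually.of_forall fun q => by
        rw [Real.norm_eq_abs]; exact hC _ _)
    rw [← integral_finsetSum _ fun i _ => hint i]
    refine integral_congr_ae (Eventually.of_forall fun q => ?_)
    show Uc j q * FunctionSpaces.Torus.laplacian (ψc n j q.1) q.2 = ∑ i, Uc j q * gL n j i q
    rw [hdL n j q.1 q.2, Finset.mul_sum]
  have hT3lim : Tendsto (fun n => ∑ j, ∑ i, ∫ q, Uc j q * gL n j i q ∂μ) atTop
      (𝓝 (∑ j, ∑ i, ∫ q, Uc j q * gLinf j i q ∂μ)) := by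
    refine tendsto_finsetSum _ fun j _ => tendsto_finsetSum _ fun i _ => ?_
    exact tendsto_integral_mul_of_tendsto_eLpNorm_two (hU2 j) (fun n => (hgLc n j i).aestronglyMeasurable)
      (hgLinf j i) (hconvL j i)
  have hT3id : ∑ j, ∑ i, ∫ q, Uc j q * gLinf j i q ∂μ =
      -∫ t in Ioo 0 T, θ t * FunctionSpaces.Torus.gradNormSq (vecConv (u t) (FunctionSpaces.Torus.kernel ε)) := by
    have hint : ∀ j i, Integrable (fun q => Uc j q * gLinf j i q) μ := fun j i => (hU2 j).integrable_mul (hgLinf j i)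
    exact integral_sum_mul_cutoff_sliceL_eq hθT hUc hL1 hε hε' hint
  ---------------------------------------------------------------- Term 4 (force)
  set gC : ℕ → d → ℝ × UnitAddTorus d → ℝ := fun n j q => ψc n j q.1 q.2 with hgCdef
  set gCinf : d → ℝ × UnitAddTorus d → ℝ := fun j q => θ q.1 * Ck j q.1 q.2 with hgCinfdef
  have hgCform : ∀ n j, gC n j = fun q => ((ρ n) ⋆ fun s => θ s * ((ρ n) ⋆ fun r => Ck j r q.2) s) q.1 := by
    intro n j
    funext q
    simp only [hgCdef]
    exact cetTest_eq_iteratedTimeConv (hUm j) (hU1 j) (hρs n) (hρc n) hKs hθ hθc q.1 q.2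
  have hgCinf : ∀ j, MemLp (gCinf j) 2 μ := fun j => hcut (hCk_sm j) (hCk2 j)
  have hconvC : ∀ j, Tendsto (fun n => eLpNorm (fun q => gC n j q - gCinf j q) 2 μ) atTop (𝓝 0) := by
    intro j
    simp_rw [hgCform]
    exact tendsto_eLpNorm_iteratedTimeConv_sub (μ := (volume : Measure (UnitAddTorus d))) hφ0 (hCk_sm j)
      one_le_two ENNReal.ofNat_ne_top (hCk2 j) hθ.continuous hCθ
  have hT4lim : Tendsto (fun n => ∑ j, ∫ q, Fc j q * gC n j q ∂μ) atTop (𝓝 (∑ j, ∫ q, Fc j q * gCinf j q ∂μ)) := by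
    refine tendsto_finsetSum _ fun j _ => ?_
    exact tendsto_integral_mul_of_tendsto_eLpNorm_two (hF2 j) (fun n => (hψcont n j).aestronglyMeasurable)
      (hgCinf j) (hconvC j)
  have hT4id : ∑ j, ∫ q, Fc j q * gCinf j q ∂μ =
      ∫ t in Ioo 0 T, θ t * ∫ x, ⟪vecConv (f t) (FunctionSpaces.Torus.kernel ε) x, vecConv (u t) (FunctionSpaces.Torus.kernel ε) x⟫_ℝ := by
    have hint : ∀ j, Integrable (fun q => Fc j q * gCinf j q) μ := fun j => (hF2 j).integrable_mul (hgCinf j)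
    exact integral_sum_mul_cutoff_sliceC_eq hθT hUc hFc hL1 hfL1 hε hε' hint
  ---------------------------------------------------------------- conclusion
  have hsum : Tendsto (fun n => ∑ j, 2⁻¹ * A n j + ∑ j, ∑ i, ∫ q, Uc j q * Uc i q * g n j i q ∂μ +
      ν * ∑ j, ∑ i, ∫ q, Uc j q * gL n j i q ∂μ + ∑ j, ∫ q, Fc j q * gC n j q ∂μ) atTop
      (𝓝 (∑ j, 2⁻¹ * Ainf j + ∑ j, ∑ i, ∫ q, Uc j q * Uc i q * ginf j i q ∂μ +
        ν * ∑ j, ∑ i, ∫ q, Uc j q * gLinf j i q ∂μ + ∑ j, ∫ q, Fc j q * gCinf j q ∂μ)) :=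
    ((hT1lim.add hT2lim).add (hT3lim.const_mul ν)).add hT4lim
  have hzero : (fun n => ∑ j, 2⁻¹ * A n j + ∑ j, ∑ i, ∫ q, Uc j q * Uc i q * g n j i q ∂μ +
      ν * ∑ j, ∑ i, ∫ q, Uc j q * gL n j i q ∂μ + ∑ j, ∫ q, Fc j q * gC n j q ∂μ) = fun _ => 0 := by
    funext n
    have h := hEn n
    simp_rw [hT1form n, hT3form n] at h
    exact h
  rw [hzero] at hsum
  have hlim := tendsto_nhds_unique (tendsto_const_nhds) hsum
  rw [hT1id, hT2id, hT3id, hT4id] at hlim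
  linarith

end Distributional

end Torus

end Literature.Analysis.FluidPDE
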